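import Literature.Probability.LatticeModels.AizenmanWickSplice
import Literature.Probability.LatticeModels.WeightedTreeBoundCorrelations
import Literature.Probability.LatticeModels.UrsellMonotonicityCases
import Literature.Probability.LatticeModels.UrsellMonotonicityClones
import Literature.Probability.LatticeModels.UrsellExplicitFormula
import HarnessLib

/-!
# Camia–Jiang–Newman 2023, Theorem 1 for `k = 2`: `|u₄|` is nondecreasing in every coupling (PROVED)

Topic `Literature/Probability/LatticeModels`; sibling PROOF file of `UrsellMonotonicity.lean` (named fact
`CamiaJiangNewman2023_thm1`: `(-1)^{k-1} ∂u_{2k}(σ_{j₁},…,σ_{j_{2k}})/∂J_{u₀v₀} ≥ 0` for ferromagnetic pair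
interactions).  This file PROVES the case `k = 2` of the body of that fact (`CamiaJiangNewman2023_thm1_two`): for
every finite set of sites `ι`, every `c ≥ 0`, every `j : Fin 4 → ι` and every `u₀ ≠ v₀`,

`0 ≤ (-1)^{2-1} · d/dt|_{t = c u₀ v₀} u₄(setCoupling c u₀ v₀ t; j)`,

i.e. `-u₄ = |u₄|` is nondecreasing in every coupling (the case `k = 1` is `UrsellMonotonicityCases.lean`; the
general `k` is NOT proved in the tree — CJN's printed proof goes through their Proposition 1, whose printed proof
has a gap, see `UrsellMonotonicityGraphPartitions.lean`).

## Part I — the double-current inequality (edge couplings `K ≥ 0` on any finite simple graph)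

For six distinct vertices `a b c d u w` and `D(T) = Σ 1{∂n₁ = T} 1{∂n₂ = ∅} w w 1{w ∉ C_{n₁+n₂}(u)}`
(`= Z[T]Z[∅] - Z[T Δ {u,w}]Z[{u,w}] = Z[∅]² ∂⟨σ_{TΔ{u,w}}⟩/∂J_{uw}` by the switching lemma):

`Z[∅] D({a,b,c,d,u,w}) ≤ Σ_{S ⊂ {a,b,c,d}, |S| = 2} Z[{a,b,c,d} ∖ S] D(S ∪ {u,w})`
(`Current.ursellTwo_currentSum_inequality`), i.e. `∂⟨σ_aσ_bσ_cσ_d⟩/∂J_{uw} ≤ Σ_S ⟨σ_{X∖S}⟩ ∂⟨σ_S⟩/∂J_{uw}`.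

The argument (ours).  Condition on the cluster `A = C_{n₁+n₂}(u)` (`w ∉ A`); by parity `|A ∩ {a,b,c,d}| ∈ {1,3}`.
* If `A ∩ {a,b,c,d} = {a}`: freezing `A`, the pair of currents splits into an inner part and an outer pair of
  currents of `G ∖ A` (`Current.pair_splice`, the two-current version of the splice identities of
  `AizenmanWickSplice.lean`), the outer pair having sources `{w,b,c,d}, ∅`.  The same conditioning of the right
  side (pairs `S = {a,b'}`) produces outer sources `{w,b'}, ∅` and the factor `Z[{c',d'}]`, which Griffiths II
  (`ecurrentSumIn_empty_mul_ecurrentSum_pair`) bounds below by `Z[∅] Z_{G∖A}[{c',d'}]/Z_{G∖A}[∅]`; Aizenman's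
  identity `Σ_{b'} Z'[wb']Z'[c'd'] = Z'[wbcd]Z'[∅] + 2P'` on `G ∖ A` (`ursellFour_currentSum_identity`) then pays
  the left side AND twice the mass `B_u` of the configurations in which moreover `w, c, d` are connected
  (`Current.frozen_cluster_inequality`, `Current.fmass_le_rmass`).
* If `|A ∩ {a,b,c,d}| = 3`: by parity of the cluster of `w`, these configurations are among those counted by
  the mirror quantity `B_w` (roles of `u` and `w` exchanged; `Current.cluster_types`, `Current.dmass_le_fmass`).
Adding the bound and its mirror image: `2·LHS ≤ (T_u + B_w) + (T_w + B_u) ≤ (T_u + 2B_u) + (T_w + 2B_w) ≤ 2·RHS`.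

## Part II — the pair-interaction average and the named fact's `k = 2` instance

* `PairIsing.ursell_four_eq` — `u₄ = ⟨σ₀σ₁σ₂σ₃⟩ - ⟨σ₀σ₁⟩⟨σ₂σ₃⟩ - ⟨σ₀σ₂⟩⟨σ₁σ₃⟩ - ⟨σ₀σ₃⟩⟨σ₁σ₂⟩` for every `c` and
  `j` (odd moments vanish by spin flip; block recursion of the Möbius inversion, `UrsellInversion`);
* `PairIsing.deriv_ursell_four` — CJN eq. (20) for `n = 4` via the fluctuation formula of
  `UrsellMonotonicityDeriv`: `∂u₄/∂J = Cov(0123) - Σ_S ⟨σ_{X∖S}⟩ Cov(S)`;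
* `PairIsing.avg_spinProduct_eq_div`, `PairIsing.cov_eq_dmass_div` — the random-current dictionary on the
  complete graph (`pairGibbs_spinProduct_eq_wcurrentSum_div`, couplings `pairEdgeWeight c 2`) and the switching
  lemma: `⟨σ_A⟩ = Z[A]/Z[∅]`, `Z[∅]² Cov(S) = D(S ∪ {u₀,v₀})`;
* `PairIsing.neg_deriv_ursell_four_nonneg` (distinct sites away from `u₀, v₀`: Part I divided by `Z[∅]³`) and
  `CamiaJiangNewman2023_thm1_two` (arbitrary `j`, `u₀ ≠ v₀`, by the clone trick of `UrsellMonotonicityClones`).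

## References

* [CamiaJiangNewman2023] F. Camia, J. Jiang, C. M. Newman, *Monotonicity of Ursell functions in the Ising
  model*, Comm. Math. Phys. 401 (2023) 2459–2482, arXiv:2207.12247, Thm 1, Remark 1, §2 eq. (20)–(22).
* M. Aizenman, Comm. Math. Phys. 86 (1982) 1–48, §5 (the `U₄` identity, conditioning on clusters)
  [AizenmanCMP1982]; R. Panis, arXiv:2309.05797, §4.1 and Proposition 4.7 [Panis2023Triviality];
  S. Friedli, Y. Velenik, CUP 2017, Thm. 3.49 (Griffiths II) [FriedliVelenik2017] — all through the tree files
  `WeightedCurrentsIdentities`, `WeightedClusterDecomposition`, `AizenmanWickSplice`, `CurrentPartitionMonotone`,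
  `WeightedTreeBoundCorrelations`.

## Not here

The general `k ≥ 3` (no complete proof is known to us: the conditioning argument produces wrong-signed
`(3,3)`-type clusters from both sides).  Nothing in this file is a named fact.
-/

noncomputable section

open Finset Filter
open scoped symmDiff ENNReal

namespace Literature.Probability.LatticeModels

variable {V : Type*} [Fintype V] [DecidableEq V] {G : SimpleGraph V} [DecidableRel G.Adj]

namespace Current

/-! ### Splicing a pair of currents against an outer pair -/

/-- Splicing is additive: `spliceOff S a c + spliceOff S b d = spliceOff S (a + b) (c + d)`. [folklore] -/
theorem spliceOff_add_spliceOff (S : Finset V) (a b c d : Current G) :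
    spliceOff S a c + spliceOff S b d = spliceOff S (a + b) (c + d) := by
  funext e
  by_cases he : EdgeOff S (e : Sym2 V) <;> simp [spliceOff, he]

/-- **The cluster of a far vertex is not affected by replacing the part of the current meeting `C(u)`.**
If `C_m(u) = A`, `w ∉ A` and `k` is supported off `A`, then `C_{spliceOff A k m}(w) = C_m(w)` (an edge
meeting both `A` and `C_m(w)` carries no current, since the two clusters are different). [folklore] -/
theorem cluster_spliceOff_eq_of_notMem {m k : Current G} {u w : V} {A : Finset V} (hA : m.cluster u = A)
    (hw : w ∉ A) (hk : IsSupp (offGraph G A) k) : (spliceOff A k m).cluster w = m.cluster w := by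
  refine cluster_eq_of_agree (m := m) (S := m.cluster w) rfl fun e he => ?_
  by_cases hoff : EdgeOff A (e : Sym2 V)
  · exact spliceOff_apply_of_edgeOff _ _ hoff
  · rw [spliceOff_apply_of_not_edgeOff _ _ hoff, (isSupp_offGraph_iff.1 hk) e hoff]
    -- `e` meets `C_m(w)` and `A = C_m(u)`; a positive current on `e` would join the two clusters
    by_contra hne
    have hpos : 0 < m e := Nat.pos_of_ne_zero (Ne.symm hne)
    simp only [EdgeOff, not_forall, not_not, exists_prop] at he hoff
    obtain ⟨p, hpe, hpC⟩ := he
    obtain ⟨q, hqe, hqA⟩ := hoff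
    have hqC : q ∈ m.cluster w := forall_mem_cluster_of_pos hpos hpe hpC q hqe
    rw [← hA] at hqA
    -- `w ~ q ~ u`
    exact hw (hA ▸ mem_cluster_comm.1 (mem_cluster_trans hqC (mem_cluster_comm.1 hqA)))

/-- The `ℝ≥0∞` weight for the cut-off couplings is the weight restricted to the currents supported off
`A`. [folklore] -/
theorem eweight_cutCoupling (K : G.edgeFinset → ℝ) (A : Finset V) (n : Current G) :
    n.eweight (cutCoupling K A) = if IsSupp (offGraph G A) n then n.eweight K else 0 := by
  unfold eweight
  rw [wweight_cutCoupling]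
  split_ifs <;> simp

/-- The pair weight for the cut-off couplings, as a weight restricted to pairs supported off `A`.
[folklore] -/
theorem epairWeight_cutCoupling (K : G.edgeFinset → ℝ) (A S T : Finset V) (q : Current G × Current G) :
    epairWeight (cutCoupling K A) S T q =
      if (IsSupp (offGraph G A) q.1 ∧ q.1.sources = S) ∧ (IsSupp (offGraph G A) q.2 ∧ q.2.sources = T) then
        q.1.eweight K * q.2.eweight K else 0 := by
  rw [epairWeight_eq_mul, eweight_cutCoupling, eweight_cutCoupling]
  by_cases h1 : IsSupp (offGraph G A) q.1 <;> by_cases h2 : IsSupp (offGraph G A) q.2 <;>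
    by_cases h3 : q.1.sources = S <;> by_cases h4 : q.2.sources = T <;> simp [h1, h2, h3, h4]

/-- **The pair splice identity** (conditioning a pair of currents on the cluster of `u`).  For `K ≥ 0`, a
vertex set `A`, a source set `T` and a weight `Φ ≥ 0` on currents which does not see the part of the
current meeting `A` (`Φ (spliceOff A k m) = Φ m` whenever `C_m(u) = A` and `k` is supported off `A`):
`(Σ_{∂p₁=T, ∂p₂=∅} w w 1{C_{p₁+p₂}(u)=A} Φ(p₁+p₂)) · (Σ_{∂q₁=∂q₂=∅} w_A w_A)
   = (Σ_{∂p₁=T∩A, ∂p₂=∅} w w 1{C_{p₁+p₂}(u)=A}) · (Σ_{∂q₁=T∖A, ∂q₂=∅} w_A w_A Φ(q₁+q₂))`,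
`w_A` the weight for the couplings cut off at `A` (currents of `G ∖ A`).  Proof: the involution
exchanging the parts off `A` of `pᵢ` and `qᵢ` (`Current.spliceOff`, `Current.splice_transfer`).
[cite: AizenmanCMP1982, §5 (conditioning on clusters)] -/
theorem pair_splice {K : G.edgeFinset → ℝ} (hK : ∀ e, 0 ≤ K e) (A T : Finset V) (u : V)
    (Φ : Current G → ℝ≥0∞)
    (hΦ : ∀ m k : Current G, m.cluster u = A → IsSupp (offGraph G A) k → Φ (spliceOff A k m) = Φ m) :
    (∑' p : Current G × Current G,
        epairWeight K T ∅ p * (if (p.1 + p.2).cluster u = A then 1 else 0) * Φ (p.1 + p.2)) *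
      (∑' q : Current G × Current G, epairWeight (cutCoupling K A) ∅ ∅ q) =
    (∑' p : Current G × Current G,
        epairWeight K (T.filter (· ∈ A)) ∅ p * (if (p.1 + p.2).cluster u = A then 1 else 0)) *
      (∑' q : Current G × Current G,
        epairWeight (cutCoupling K A) (T.filter (· ∉ A)) ∅ q * Φ (q.1 + q.2)) := by
  -- normal forms of the two sides as sums over quadruples
  set PA : (Current G × Current G) × (Current G × Current G) → Prop := fun x =>
    (x.1.1.sources = T ∧ x.1.2.sources = ∅) ∧ (x.1.1 + x.1.2).cluster u = A ∧
      ((IsSupp (offGraph G A) x.2.1 ∧ x.2.1.sources = ∅) ∧ (IsSupp (offGraph G A) x.2.2 ∧ x.2.2.sources = ∅))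
    with hPA
  set PB : (Current G × Current G) × (Current G × Current G) → Prop := fun x =>
    (x.1.1.sources = T.filter (· ∈ A) ∧ x.1.2.sources = ∅) ∧ (x.1.1 + x.1.2).cluster u = A ∧
      ((IsSupp (offGraph G A) x.2.1 ∧ x.2.1.sources = T.filter (· ∉ A)) ∧
        (IsSupp (offGraph G A) x.2.2 ∧ x.2.2.sources = ∅)) with hPB
  set wA : (Current G × Current G) × (Current G × Current G) → ℝ≥0∞ := fun x =>
    x.1.1.eweight K * x.1.2.eweight K * Φ (x.1.1 + x.1.2) * (x.2.1.eweight K * x.2.2.eweight K) with hwA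
  set wB : (Current G × Current G) × (Current G × Current G) → ℝ≥0∞ := fun x =>
    x.1.1.eweight K * x.1.2.eweight K * (x.2.1.eweight K * x.2.2.eweight K * Φ (x.2.1 + x.2.2)) with hwB
  have hL : (∑' p : Current G × Current G,
        epairWeight K T ∅ p * (if (p.1 + p.2).cluster u = A then 1 else 0) * Φ (p.1 + p.2)) *
      (∑' q : Current G × Current G, epairWeight (cutCoupling K A) ∅ ∅ q) =
      ∑' x, (if PA x then wA x else 0) := by
    rw [tsum_mul_tsum_eq_tsum_prod]
    refine tsum_congr fun x => ?_
    rw [epairWeight_cutCoupling, epairWeight]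
    by_cases h1 : x.1.1.sources = T ∧ x.1.2.sources = ∅ <;>
      by_cases h2 : (x.1.1 + x.1.2).cluster u = A <;>
      by_cases h3 : (IsSupp (offGraph G A) x.2.1 ∧ x.2.1.sources = ∅) ∧
        (IsSupp (offGraph G A) x.2.2 ∧ x.2.2.sources = ∅) <;>
      simp [hPA, hwA, h1, h2, h3, mul_assoc]
  have hR : (∑' p : Current G × Current G,
        epairWeight K (T.filter (· ∈ A)) ∅ p * (if (p.1 + p.2).cluster u = A then 1 else 0)) *
      (∑' q : Current G × Current G,
        epairWeight (cutCoupling K A) (T.filter (· ∉ A)) ∅ q * Φ (q.1 + q.2)) =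
      ∑' x, (if PB x then wB x else 0) := by
    rw [tsum_mul_tsum_eq_tsum_prod]
    refine tsum_congr fun x => ?_
    rw [epairWeight_cutCoupling, epairWeight]
    by_cases h1 : x.1.1.sources = T.filter (· ∈ A) ∧ x.1.2.sources = ∅ <;>
      by_cases h2 : (x.1.1 + x.1.2).cluster u = A <;>
      by_cases h3 : (IsSupp (offGraph G A) x.2.1 ∧ x.2.1.sources = T.filter (· ∉ A)) ∧
        (IsSupp (offGraph G A) x.2.2 ∧ x.2.2.sources = ∅) <;>
      simp [hPB, hwB, h1, h2, h3, mul_assoc]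
  rw [hL, hR]
  -- the involution
  set f : (Current G × Current G) × (Current G × Current G) → (Current G × Current G) × (Current G × Current G) :=
    fun x => ((spliceOff A x.1.1 x.2.1, spliceOff A x.1.2 x.2.2), (spliceOff A x.2.1 x.1.1, spliceOff A x.2.2 x.1.2))
    with hf
  have hinv : Function.Involutive f := by
    rintro ⟨⟨p₁, p₂⟩, ⟨q₁, q₂⟩⟩
    simp only [hf, spliceOff_spliceOff]
  -- transfer of the constraints along `f`
  have htrans : ∀ x, PA x → PB (f x) ∧ wA x = wB (f x) := by
    rintro ⟨⟨p₁, p₂⟩, ⟨q₁, q₂⟩⟩ ⟨⟨hp₁, hp₂⟩, hC, ⟨hq₁, hq₁s⟩, ⟨hq₂, hq₂s⟩⟩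
    have hC' : (p₂ + p₁).cluster u = A := by rwa [add_comm]
    obtain ⟨-, hsupp₁, hsrc₁, hsrc₁'⟩ := splice_transfer hC' hq₁
    obtain ⟨-, hsupp₂, hsrc₂, hsrc₂'⟩ := splice_transfer hC hq₂
    have hCf : (spliceOff A p₁ q₁ + spliceOff A p₂ q₂).cluster u = A :=
      cluster_eq_of_agree hC fun e he => by
        simp only [Pi.add_apply, spliceOff_apply_of_not_edgeOff _ _ he]
    refine ⟨⟨⟨?_, ?_⟩, hCf, ⟨hsupp₁, ?_⟩, ⟨hsupp₂, ?_⟩⟩, ?_⟩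
    · rw [hsrc₁', hp₁, hq₁s, Finset.filter_empty, Finset.union_empty]
    · rw [hsrc₂', hp₂, hq₂s, Finset.filter_empty, Finset.filter_empty, Finset.union_empty]
    · rw [hsrc₁, hp₁]
    · rw [hsrc₂, hp₂, Finset.filter_empty]
    · -- weights and the event
      have hΦ' : Φ (spliceOff A q₁ p₁ + spliceOff A q₂ p₂) = Φ (p₁ + p₂) := by
        rw [spliceOff_add_spliceOff]
        exact hΦ (p₁ + p₂) (q₁ + q₂) hC (isSupp_add hq₁ hq₂)
      change wA ((p₁, p₂), (q₁, q₂)) = wB (f ((p₁, p₂), (q₁, q₂)))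
      simp only [hwA, hwB, hf, hΦ']
      calc p₁.eweight K * p₂.eweight K * Φ (p₁ + p₂) * (q₁.eweight K * q₂.eweight K)
          = (p₁.eweight K * q₁.eweight K) * (p₂.eweight K * q₂.eweight K) * Φ (p₁ + p₂) := by ring
        _ = ((spliceOff A p₁ q₁).eweight K * (spliceOff A q₁ p₁).eweight K) *
              ((spliceOff A p₂ q₂).eweight K * (spliceOff A q₂ p₂).eweight K) * Φ (p₁ + p₂) := by
            rw [eweight_spliceOff_mul_eweight_spliceOff hK A p₁ q₁,
              eweight_spliceOff_mul_eweight_spliceOff hK A p₂ q₂]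
        _ = _ := by ring
  have hback : ∀ x, PB (f x) → PA x := by
    rintro ⟨⟨p₁, p₂⟩, ⟨q₁, q₂⟩⟩ ⟨⟨hp₁, hp₂⟩, hC, ⟨hq₁, hq₁s⟩, ⟨hq₂, hq₂s⟩⟩
    simp only [hf] at hp₁ hp₂ hC hq₁ hq₁s hq₂ hq₂s
    have hC' : (spliceOff A p₂ q₂ + spliceOff A p₁ q₁).cluster u = A := by rwa [add_comm]
    obtain ⟨-, hsupp₁, hsrc₁, hsrc₁'⟩ := splice_transfer hC' hq₁
    obtain ⟨-, hsupp₂, hsrc₂, hsrc₂'⟩ := splice_transfer hC hq₂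
    rw [spliceOff_spliceOff] at hsupp₁ hsrc₁ hsrc₁' hsupp₂ hsrc₂ hsrc₂'
    have hCb : (p₁ + p₂).cluster u = A := by
      refine cluster_eq_of_agree hC fun e he => ?_
      simp only [Pi.add_apply, spliceOff]
      by_cases ho : EdgeOff A (e : Sym2 V)
      · exact absurd ho he
      · simp [ho]
    refine ⟨⟨?_, ?_⟩, hCb, ⟨hsupp₁, ?_⟩, ⟨hsupp₂, ?_⟩⟩
    · rw [hsrc₁', hp₁, hq₁s, Finset.filter_filter, Finset.filter_filter]
      have h1 : T.filter (fun x => x ∈ A ∧ x ∈ A) = T.filter (· ∈ A) :=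
        Finset.filter_congr fun x _ => and_self_iff
      have h2 : T.filter (fun x => x ∉ A ∧ x ∉ A) = T.filter (· ∉ A) :=
        Finset.filter_congr fun x _ => and_self_iff
      rw [h1, h2, Finset.filter_union_filter_not_eq]
    · rw [hsrc₂', hp₂, hq₂s, Finset.filter_empty, Finset.filter_empty, Finset.union_empty]
    · rw [hsrc₁, hp₁, Finset.filter_filter]
      exact Finset.filter_false_of_mem fun x _ h => h.2 h.1
    · rw [hsrc₂, hp₂, Finset.filter_empty]
  classical
  exact tsum_ite_eq_of_involutive f hinv PA PB wA wB (fun x hx => (htrans x hx).1)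
    (fun q hq => hback (f q) (by rw [hinv q]; exact hq)) (fun x hx => (htrans x hx).2)

/-! ### Frozen-cluster pair masses and their splice identities -/

variable {K : G.edgeFinset → ℝ}

/-- **The frozen-cluster pair mass** `M^Φ_A(T) = Σ 1{∂p₁ = T} 1{∂p₂ = ∅} w w 1{C_{p₁+p₂}(u) = A} Φ(p₁+p₂)`.
[cite: AizenmanCMP1982, §5 (conditioning on clusters)] -/
def pmass (K : G.edgeFinset → ℝ) (u : V) (A T : Finset V) (Φ : Current G → ℝ≥0∞) : ℝ≥0∞ :=
  ∑' p : Current G × Current G,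
    epairWeight K T ∅ p * (if (p.1 + p.2).cluster u = A then 1 else 0) * Φ (p.1 + p.2)

/-- `Σ 1{∂q₁ = S}1{∂q₂ = ∅} w_A w_A Φ(q₁+q₂)` for the couplings cut off at `A`. [folklore] -/
def outerMass (K : G.edgeFinset → ℝ) (A S : Finset V) (Φ : Current G → ℝ≥0∞) : ℝ≥0∞ :=
  ∑' q : Current G × Current G, epairWeight (cutCoupling K A) S ∅ q * Φ (q.1 + q.2)

/-- `outerMass` with `Φ = 1` is `Z_A[S] Z_A[∅]`. [folklore] -/
theorem outerMass_one (K : G.edgeFinset → ℝ) (A S : Finset V) :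
    outerMass K A S (fun _ => 1) = ecurrentSum (cutCoupling K A) S * ecurrentSum (cutCoupling K A) ∅ := by
  unfold outerMass
  simp only [mul_one]
  exact tsum_epairWeight _ S ∅

/-- `M^1_A(T) ≤ Z[T] Z[∅] < ∞`. [folklore] -/
theorem pmass_one_ne_top (hK : ∀ e, 0 ≤ K e) (u : V) (A T : Finset V) : pmass K u A T (fun _ => 1) ≠ ∞ := by
  refine ne_top_of_le_ne_top (ENNReal.mul_ne_top (ecurrentSum_ne_top hK T) (ecurrentSum_ne_top hK ∅)) ?_
  rw [← tsum_epairWeight]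
  unfold pmass
  refine ENNReal.tsum_le_tsum fun p => ?_
  simp only [mul_one]
  calc epairWeight K T ∅ p * (if (p.1 + p.2).cluster u = A then 1 else 0) ≤ epairWeight K T ∅ p * 1 :=
        mul_le_mul' le_rfl (by split_ifs <;> simp)
    _ = _ := mul_one _

/-- `Z_A[∅] ≠ 0`. [folklore] -/
theorem ecurrentSum_cutCoupling_empty_ne_zero (K : G.edgeFinset → ℝ) (A : Finset V) :
    ecurrentSum (cutCoupling K A) (∅ : Finset V) ≠ 0 := ecurrentSum_empty_ne_zero _

/-- `Z_A[S] ≠ ∞` for `K ≥ 0`. [folklore] -/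
theorem ecurrentSum_cutCoupling_ne_top (hK : ∀ e, 0 ≤ K e) (A S : Finset V) :
    ecurrentSum (cutCoupling K A) S ≠ ∞ := ecurrentSum_ne_top (cutCoupling_nonneg hK A) S

/-- **The pair splice identity for the frozen-cluster masses**:
`M^Φ_A(T) · Z_A[∅]² = M^1_A(T ∩ A) · Σ 1{∂q₁ = T∖A}1{∂q₂=∅} w_A w_A Φ(q₁+q₂)` for `Φ` not seeing the part of
the current meeting `A`. [cite: AizenmanCMP1982, §5 (conditioning on clusters)] -/
theorem pmass_mul_eq (hK : ∀ e, 0 ≤ K e) (u : V) (A T : Finset V) (Φ : Current G → ℝ≥0∞)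
    (hΦ : ∀ m k : Current G, m.cluster u = A → IsSupp (offGraph G A) k → Φ (spliceOff A k m) = Φ m) :
    pmass K u A T Φ * (ecurrentSum (cutCoupling K A) ∅ * ecurrentSum (cutCoupling K A) ∅) =
      pmass K u A (T.filter (· ∈ A)) (fun _ => 1) * outerMass K A (T.filter (· ∉ A)) Φ := by
  have h := pair_splice hK A T u Φ hΦ
  rw [tsum_epairWeight] at h
  unfold pmass outerMass
  simp only [mul_one]
  exact h

/-- The case `Φ = 1`: `M_A(T) · Z_A[∅] = M_A(T ∩ A) · Z_A[T ∖ A]`. [cite: AizenmanCMP1982, §5 (conditioning on clusters)] -/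
theorem pmass_one_mul_eq (hK : ∀ e, 0 ≤ K e) (u : V) (A T : Finset V) :
    pmass K u A T (fun _ => 1) * ecurrentSum (cutCoupling K A) ∅ =
      pmass K u A (T.filter (· ∈ A)) (fun _ => 1) * ecurrentSum (cutCoupling K A) (T.filter (· ∉ A)) := by
  have h := pmass_mul_eq hK u A T (fun _ => 1) (fun _ _ _ _ => rfl)
  rw [outerMass_one, ← mul_assoc, ← mul_assoc] at h
  exact (ENNReal.mul_left_inj (ecurrentSum_cutCoupling_empty_ne_zero K A)
    (ecurrentSum_cutCoupling_ne_top hK A ∅)).1 h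

/-! ### Small set identities -/

omit [Fintype V] in
/-- `{w} Δ ({y₁} Δ ({y₂} Δ {y₃})) = {y₁, y₂, y₃, w}` for distinct vertices. [folklore] -/
theorem symmDiff_four_eq {w y₁ y₂ y₃ : V} (hw₁ : w ≠ y₁) (hw₂ : w ≠ y₂) (hw₃ : w ≠ y₃) (h₁₂ : y₁ ≠ y₂)
    (h₁₃ : y₁ ≠ y₃) (h₂₃ : y₂ ≠ y₃) :
    ({w} : Finset V) ∆ ({y₁} ∆ ({y₂} ∆ {y₃})) = {y₁, y₂, y₃, w} := by
  ext v
  simp only [Finset.mem_symmDiff, Finset.mem_singleton, Finset.mem_insert]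
  by_cases h1 : v = y₁
  · subst h1; simp [hw₁.symm, h₁₂, h₁₃]
  · by_cases h2 : v = y₂
    · subst h2; simp [hw₂.symm, h₁₂.symm, h₂₃]
    · by_cases h3 : v = y₃
      · subst h3; simp [hw₃.symm, h₁₃.symm, h₂₃.symm]
      · by_cases h4 : v = w
        · subst h4; simp [hw₁, hw₂, hw₃]
        · simp [h1, h2, h3, h4]

omit [Fintype V] in
/-- `({w} Δ ({y₁} Δ ({y₂} Δ {y₃}))) Δ ({y₂} Δ {y₃}) = {w} Δ {y₁}`. [folklore] -/
theorem symmDiff_four_symmDiff_pair (w y₁ y₂ y₃ : V) :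
    (({w} : Finset V) ∆ ({y₁} ∆ ({y₂} ∆ {y₃}))) ∆ ({y₂} ∆ {y₃}) = {w} ∆ {y₁} := by
  rw [show ({w} : Finset V) ∆ ({y₁} ∆ ({y₂} ∆ {y₃})) = ({w} ∆ {y₁}) ∆ ({y₂} ∆ {y₃}) from
    (symmDiff_assoc _ _ _).symm, symmDiff_assoc, symmDiff_self, symmDiff_bot]

/-! ### The conditioned inequality for one frozen cluster of type `A ∩ {a,b,c,d} = {x}` -/

/-- The connection weight `1{y₂ ∈ C(w)} 1{y₃ ∈ C(y₂)}` ("`w, y₂, y₃` are connected"). [folklore] -/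
def conn₃ (w y₂ y₃ : V) (m : Current G) : ℝ≥0∞ :=
  (if y₂ ∈ m.cluster w then 1 else 0) * (if y₃ ∈ m.cluster y₂ then 1 else 0)

/-- `conn₃ ≤ 1`. [folklore] -/
theorem conn₃_le_one (w y₂ y₃ : V) (m : Current G) : conn₃ w y₂ y₃ m ≤ 1 := by
  unfold conn₃; split_ifs <;> simp

/-- `conn₃ w y₂ y₃` does not see the part of the current meeting `A = C(u)` when `w, y₂ ∉ A`. [folklore] -/
theorem conn₃_spliceOff {u w y₂ y₃ : V} {A : Finset V} (hw : w ∉ A) (hy₂ : y₂ ∉ A) (m k : Current G)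
    (hA : m.cluster u = A) (hk : IsSupp (offGraph G A) k) : conn₃ w y₂ y₃ (spliceOff A k m) = conn₃ w y₂ y₃ m := by
  unfold conn₃
  rw [cluster_spliceOff_eq_of_notMem hA hw hk, cluster_spliceOff_eq_of_notMem hA hy₂ hk]

/-- **Griffiths II in current-sum form**: `Z[∅] · Z_A[{z,t}] ≤ Z[{z,t}] · Z_A[∅]` (the two-point function
of `G ∖ A` is at most that of `G`). [cite: FriedliVelenik2017, Thm. 3.49] -/
theorem ecurrentSum_empty_mul_cutCoupling_pair_le (hK : ∀ e, 0 ≤ K e) (A : Finset V) (z t : V) :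
    ecurrentSum K ∅ * ecurrentSum (cutCoupling K A) ({z} ∆ {t}) ≤
      ecurrentSum K ({z} ∆ {t}) * ecurrentSum (cutCoupling K A) ∅ := by
  have h := ecurrentSumIn_empty_mul_ecurrentSum_pair (offGraph G A) hK z t
  rw [ecurrentSumIn_offGraph_eq_cutCoupling, ecurrentSumIn_offGraph_eq_cutCoupling] at h
  calc ecurrentSum K ∅ * ecurrentSum (cutCoupling K A) ({z} ∆ {t})
      = ecurrentSum (cutCoupling K A) ({z} ∆ {t}) * ecurrentSum K ∅ := mul_comm _ _
    _ ≤ ecurrentSum (cutCoupling K A) ({z} ∆ {t}) * ecurrentSum K ∅ + _ := le_self_add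
    _ = ecurrentSum (cutCoupling K A) ∅ * ecurrentSum K ({z} ∆ {t}) := h.symm
    _ = _ := mul_comm _ _

/-- The same for an explicit pair `{z, t}`, `z ≠ t`. [cite: FriedliVelenik2017, Thm. 3.49] -/
theorem ecurrentSum_empty_mul_cutCoupling_pair_le' (hK : ∀ e, 0 ≤ K e) (A : Finset V) {z t : V} (hzt : z ≠ t) :
    ecurrentSum K ∅ * ecurrentSum (cutCoupling K A) {z, t} ≤ ecurrentSum K {z, t} * ecurrentSum (cutCoupling K A) ∅ := by
  rw [← symmDiff_singleton_eq_pair hzt]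
  exact ecurrentSum_empty_mul_cutCoupling_pair_le hK A z t

/-- **Aizenman's intersection term, switched**: for `K' ≥ 0` and distinct `w, y₁, y₂, y₃`,
`Σ 1{∂q₁={w,y₁}}1{∂q₂={y₂,y₃}} w w 1{y₂ ∈ C(w)} = Σ 1{∂q₁={y₁,y₂,y₃,w}}1{∂q₂=∅} w w 1{y₂ ∈ C(w)}1{y₃ ∈ C(y₂)}`.
[cite: Panis2023Triviality, Proposition 4.7] -/
theorem tsum_epairWeight_pair_pair_indicator_eq {K' : G.edgeFinset → ℝ} (hK' : ∀ e, 0 ≤ K' e) {w y₁ y₂ y₃ : V}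
    (hw₁ : w ≠ y₁) (hw₂ : w ≠ y₂) (hw₃ : w ≠ y₃) (h₁₂ : y₁ ≠ y₂) (h₁₃ : y₁ ≠ y₃) (h₂₃ : y₂ ≠ y₃) :
    ∑' q : Current G × Current G, epairWeight K' ({w} ∆ {y₁}) ({y₂} ∆ {y₃}) q *
        (if y₂ ∈ (q.1 + q.2).cluster w then 1 else 0) =
      ∑' q : Current G × Current G, epairWeight K' {y₁, y₂, y₃, w} ∅ q * conn₃ w y₂ y₃ (q.1 + q.2) := by
  have hsw := tsum_epairWeight_switch_pair hK' ({w} ∆ ({y₁} ∆ ({y₂} ∆ {y₃}))) y₂ y₃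
    (fun m => if y₂ ∈ m.cluster w then 1 else 0)
  rw [symmDiff_four_symmDiff_pair, symmDiff_four_eq hw₁ hw₂ hw₃ h₁₂ h₁₃ h₂₃] at hsw
  rw [hsw]
  rfl

/-- **Aizenman's `U₄` identity for four distinct vertices, explicit-pair form**: for `K' ≥ 0`,
`Z[{y₁,w}]Z[{y₂,y₃}] + Z[{y₂,w}]Z[{y₁,y₃}] + Z[{y₃,w}]Z[{y₁,y₂}]
   = Z[{y₁,y₂,y₃,w}]Z[∅] + 2 Σ 1{∂q₁={y₁,y₂,y₃,w}}1{∂q₂=∅} w w 1{y₂ ∈ C(w)}1{y₃ ∈ C(y₂)}`.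
[cite: Panis2023Triviality, Proposition 4.7] -/
theorem ursellFour_currentSum_identity_pairs {K' : G.edgeFinset → ℝ} (hK' : ∀ e, 0 ≤ K' e) {w y₁ y₂ y₃ : V}
    (hw₁ : w ≠ y₁) (hw₂ : w ≠ y₂) (hw₃ : w ≠ y₃) (h₁₂ : y₁ ≠ y₂) (h₁₃ : y₁ ≠ y₃) (h₂₃ : y₂ ≠ y₃) :
    ecurrentSum K' {y₁, w} * ecurrentSum K' {y₂, y₃} + ecurrentSum K' {y₂, w} * ecurrentSum K' {y₁, y₃} +
        ecurrentSum K' {y₃, w} * ecurrentSum K' {y₁, y₂} =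
      ecurrentSum K' {y₁, y₂, y₃, w} * ecurrentSum K' ∅ +
        2 * ∑' q : Current G × Current G, epairWeight K' {y₁, y₂, y₃, w} ∅ q * conn₃ w y₂ y₃ (q.1 + q.2) := by
  have h := ursellFour_currentSum_identity hK' w y₁ y₂ y₃
  rw [tsum_epairWeight_pair_pair_indicator_eq hK' hw₁ hw₂ hw₃ h₁₂ h₁₃ h₂₃,
    symmDiff_four_eq hw₁ hw₂ hw₃ h₁₂ h₁₃ h₂₃, symmDiff_singleton_eq_pair hw₁, symmDiff_singleton_eq_pair hw₂,
    symmDiff_singleton_eq_pair hw₃, symmDiff_singleton_eq_pair h₁₂, symmDiff_singleton_eq_pair h₁₃,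
    symmDiff_singleton_eq_pair h₂₃, Finset.pair_comm w y₁, Finset.pair_comm w y₂, Finset.pair_comm w y₃] at h
  exact h

/-- **The frozen-cluster inequality.**  Let `x, u ∈ A` and `y₁, y₂, y₃, w ∉ A` (`w, y₁, y₂, y₃` distinct),
`T = {x,y₁,y₂,y₃,u,w}`, `Sᵢ = {x,yᵢ,u,w}`.  Then
`Z[∅] M_A(T) + 2 Z[∅] M^{conn₃ w y₂ y₃}_A(T) ≤ Z[{y₂,y₃}] M_A(S₁) + Z[{y₁,y₃}] M_A(S₂) + Z[{y₁,y₂}] M_A(S₃)`: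
after multiplication by `Z_A[∅]²` and the splice identities both sides carry the factor `M_A({x,u})`, the right
side becomes `≥ Z[∅] M_A({x,u}) Σᵢ Z_A[{yᵢ,w}] Z_A[{y',y''}]` by Griffiths II, and Aizenman's identity on `G ∖ A`
evaluates the sum as `Z_A[{y₁,y₂,y₃,w}]Z_A[∅] + 2P_A`. [cite: AizenmanCMP1982, §5 (conditioning on clusters)] -/
theorem frozen_cluster_inequality (hK : ∀ e, 0 ≤ K e) {x y₁ y₂ y₃ u w : V} {A : Finset V}
    (hx : x ∈ A) (hu : u ∈ A) (hw : w ∉ A) (hy₁ : y₁ ∉ A) (hy₂ : y₂ ∉ A) (hy₃ : y₃ ∉ A)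
    (hw₁ : w ≠ y₁) (hw₂ : w ≠ y₂) (hw₃ : w ≠ y₃) (h₁₂ : y₁ ≠ y₂) (h₁₃ : y₁ ≠ y₃) (h₂₃ : y₂ ≠ y₃) :
    ecurrentSum K ∅ * pmass K u A {x, y₁, y₂, y₃, u, w} (fun _ => 1) +
        2 * (ecurrentSum K ∅ * pmass K u A {x, y₁, y₂, y₃, u, w} (conn₃ w y₂ y₃)) ≤
      ecurrentSum K {y₂, y₃} * pmass K u A {x, y₁, u, w} (fun _ => 1) +
        ecurrentSum K {y₁, y₃} * pmass K u A {x, y₂, u, w} (fun _ => 1) +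
        ecurrentSum K {y₁, y₂} * pmass K u A {x, y₃, u, w} (fun _ => 1) := by
  -- notation
  set ZA : Finset V → ℝ≥0∞ := fun S => ecurrentSum (cutCoupling K A) S with hZA
  set Z : Finset V → ℝ≥0∞ := fun S => ecurrentSum K S with hZ
  set M₀ : ℝ≥0∞ := pmass K u A {x, u} (fun _ => 1) with hM₀
  set Q : ℝ≥0∞ := outerMass K A {y₁, y₂, y₃, w} (conn₃ w y₂ y₃) with hQ
  set MT : ℝ≥0∞ := pmass K u A {x, y₁, y₂, y₃, u, w} (fun _ => 1) with hMT
  set MTΦ : ℝ≥0∞ := pmass K u A {x, y₁, y₂, y₃, u, w} (conn₃ w y₂ y₃) with hMTΦ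
  set M₁ : ℝ≥0∞ := pmass K u A {x, y₁, u, w} (fun _ => 1) with hM₁
  set M₂ : ℝ≥0∞ := pmass K u A {x, y₂, u, w} (fun _ => 1) with hM₂
  set M₃ : ℝ≥0∞ := pmass K u A {x, y₃, u, w} (fun _ => 1) with hM₃
  have hZA0 : ZA ∅ ≠ 0 := ecurrentSum_cutCoupling_empty_ne_zero K A
  have hZAtop : ZA ∅ ≠ ∞ := ecurrentSum_cutCoupling_ne_top hK A ∅
  -- the filters
  have hfT₁ : ({x, y₁, y₂, y₃, u, w} : Finset V).filter (· ∈ A) = {x, u} := by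
    simp [Finset.filter_insert, Finset.filter_singleton, hx, hu, hw, hy₁, hy₂, hy₃]
  have hfT₂ : ({x, y₁, y₂, y₃, u, w} : Finset V).filter (· ∉ A) = {y₁, y₂, y₃, w} := by
    simp [Finset.filter_insert, Finset.filter_singleton, hx, hu, hw, hy₁, hy₂, hy₃]
  have hfS : ∀ y : V, y ∉ A → (({x, y, u, w} : Finset V).filter (· ∈ A) = {x, u} ∧
      ({x, y, u, w} : Finset V).filter (· ∉ A) = {y, w}) := fun y hy => by
    constructor <;> simp [Finset.filter_insert, Finset.filter_singleton, hx, hu, hw, hy]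
  -- splice identities
  have hT : MT * ZA ∅ = M₀ * ZA {y₁, y₂, y₃, w} := by
    have h := pmass_one_mul_eq hK u A ({x, y₁, y₂, y₃, u, w} : Finset V)
    rwa [hfT₁, hfT₂] at h
  have hTΦ : MTΦ * (ZA ∅ * ZA ∅) = M₀ * Q := by
    have h := pmass_mul_eq hK u A ({x, y₁, y₂, y₃, u, w} : Finset V) (conn₃ w y₂ y₃)
      (fun m k hA hk => conn₃_spliceOff hw hy₂ m k hA hk)
    rwa [hfT₁, hfT₂] at h
  have hS : ∀ y : V, y ∉ A → pmass K u A {x, y, u, w} (fun _ => 1) * ZA ∅ = M₀ * ZA {y, w} := fun y hy => by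
    have h := pmass_one_mul_eq hK u A ({x, y, u, w} : Finset V)
    rwa [(hfS y hy).1, (hfS y hy).2] at h
  -- Aizenman's identity on `G ∖ A`
  have hAiz : ZA {y₁, w} * ZA {y₂, y₃} + ZA {y₂, w} * ZA {y₁, y₃} + ZA {y₃, w} * ZA {y₁, y₂} =
      ZA {y₁, y₂, y₃, w} * ZA ∅ + 2 * Q :=
    ursellFour_currentSum_identity_pairs (cutCoupling_nonneg hK A) hw₁ hw₂ hw₃ h₁₂ h₁₃ h₂₃
  -- Griffiths II for the three pairs
  have hG₁ : Z ∅ * ZA {y₂, y₃} ≤ Z {y₂, y₃} * ZA ∅ := ecurrentSum_empty_mul_cutCoupling_pair_le' hK A h₂₃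
  have hG₂ : Z ∅ * ZA {y₁, y₃} ≤ Z {y₁, y₃} * ZA ∅ := ecurrentSum_empty_mul_cutCoupling_pair_le' hK A h₁₃
  have hG₃ : Z ∅ * ZA {y₁, y₂} ≤ Z {y₁, y₂} * ZA ∅ := ecurrentSum_empty_mul_cutCoupling_pair_le' hK A h₁₂
  -- compare after multiplication by `Z_A[∅]²`
  have hZZ0 : ZA ∅ * ZA ∅ ≠ 0 := mul_ne_zero hZA0 hZA0
  have hZZtop : ZA ∅ * ZA ∅ ≠ ∞ := ENNReal.mul_ne_top hZAtop hZAtop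
  rw [← ENNReal.mul_le_mul_iff_right hZZ0 hZZtop, mul_comm (ZA ∅ * ZA ∅), mul_comm (ZA ∅ * ZA ∅)]
  have hL : (Z ∅ * MT + 2 * (Z ∅ * MTΦ)) * (ZA ∅ * ZA ∅) = Z ∅ * M₀ * (ZA {y₁, y₂, y₃, w} * ZA ∅ + 2 * Q) := by
    calc (Z ∅ * MT + 2 * (Z ∅ * MTΦ)) * (ZA ∅ * ZA ∅)
        = Z ∅ * (MT * ZA ∅) * ZA ∅ + 2 * Z ∅ * (MTΦ * (ZA ∅ * ZA ∅)) := by ring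
      _ = Z ∅ * (M₀ * ZA {y₁, y₂, y₃, w}) * ZA ∅ + 2 * Z ∅ * (M₀ * Q) := by rw [hT, hTΦ]
      _ = _ := by ring
  have hR : (Z {y₂, y₃} * M₁ + Z {y₁, y₃} * M₂ + Z {y₁, y₂} * M₃) * (ZA ∅ * ZA ∅) =
      M₀ * ((Z {y₂, y₃} * ZA ∅) * ZA {y₁, w} + (Z {y₁, y₃} * ZA ∅) * ZA {y₂, w} + (Z {y₁, y₂} * ZA ∅) * ZA {y₃, w}) := by
    calc (Z {y₂, y₃} * M₁ + Z {y₁, y₃} * M₂ + Z {y₁, y₂} * M₃) * (ZA ∅ * ZA ∅)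
        = Z {y₂, y₃} * (M₁ * ZA ∅) * ZA ∅ + Z {y₁, y₃} * (M₂ * ZA ∅) * ZA ∅ + Z {y₁, y₂} * (M₃ * ZA ∅) * ZA ∅ := by
          ring
      _ = Z {y₂, y₃} * (M₀ * ZA {y₁, w}) * ZA ∅ + Z {y₁, y₃} * (M₀ * ZA {y₂, w}) * ZA ∅ +
            Z {y₁, y₂} * (M₀ * ZA {y₃, w}) * ZA ∅ := by rw [hS y₁ hy₁, hS y₂ hy₂, hS y₃ hy₃]
      _ = _ := by ring
  rw [hL, hR]
  calc Z ∅ * M₀ * (ZA {y₁, y₂, y₃, w} * ZA ∅ + 2 * Q)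
      = M₀ * (Z ∅ * (ZA {y₁, w} * ZA {y₂, y₃} + ZA {y₂, w} * ZA {y₁, y₃} + ZA {y₃, w} * ZA {y₁, y₂})) := by
        rw [hAiz]; ring
    _ = M₀ * ((Z ∅ * ZA {y₂, y₃}) * ZA {y₁, w} + (Z ∅ * ZA {y₁, y₃}) * ZA {y₂, w} + (Z ∅ * ZA {y₁, y₂}) * ZA {y₃, w}) := by
        ring
    _ ≤ M₀ * ((Z {y₂, y₃} * ZA ∅) * ZA {y₁, w} + (Z {y₁, y₃} * ZA ∅) * ZA {y₂, w} + (Z {y₁, y₂} * ZA ∅) * ZA {y₃, w}) := by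
        gcongr

/-! ### Resolving pair sums by the value of the cluster of `u` -/

/-- **Resolving a pair `tsum` by the value of a cluster**:
`∑_p f(p) g(C_{p₁+p₂}(u)) = ∑_C (∑_p f(p) 𝟙[C_{p₁+p₂}(u) = C]) g(C)`. [folklore] -/
theorem tsum_pair_mul_apply_cluster_eq_sum (f : Current G × Current G → ℝ≥0∞) (g : Finset V → ℝ≥0∞) (u : V) :
    ∑' p : Current G × Current G, f p * g ((p.1 + p.2).cluster u) =
      ∑ C : Finset V, (∑' p : Current G × Current G, f p * (if (p.1 + p.2).cluster u = C then 1 else 0)) * g C := by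
  have h : ∀ p : Current G × Current G, f p * g ((p.1 + p.2).cluster u) =
      ∑ C : Finset V, f p * (if (p.1 + p.2).cluster u = C then 1 else 0) * g C := by
    intro p
    rw [Finset.sum_eq_single ((p.1 + p.2).cluster u) (fun C _ hC => by rw [if_neg (Ne.symm hC), mul_zero, zero_mul])
      (fun h => absurd (Finset.mem_univ _) h), if_pos rfl, mul_one]
  rw [tsum_congr h, Summable.tsum_finsetSum (fun _ _ => ENNReal.summable)]
  exact Finset.sum_congr rfl fun C _ => ENNReal.tsum_mul_right

/-- **Resolving over a family of values**: `∑_p f(p) 𝟙[C_{p₁+p₂}(u) ∈ 𝓕] Ψ(p) = ∑_{C ∈ 𝓕} ∑_p f(p) 𝟙[C(u) = C] Ψ(p)`.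
[folklore] -/
theorem tsum_pair_mul_ite_mem_eq_sum (f : Current G × Current G → ℝ≥0∞) (Ψ : Current G × Current G → ℝ≥0∞)
    (u : V) (F : Finset (Finset V)) :
    ∑' p : Current G × Current G, f p * (if (p.1 + p.2).cluster u ∈ F then 1 else 0) * Ψ p =
      ∑ C ∈ F, ∑' p : Current G × Current G, f p * (if (p.1 + p.2).cluster u = C then 1 else 0) * Ψ p := by
  rw [← Summable.tsum_finsetSum (fun _ _ => ENNReal.summable)]
  refine tsum_congr fun p => ?_
  rw [← Finset.sum_mul, ← Finset.mul_sum]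
  congr 2
  exact (Finset.sum_ite_eq F ((p.1 + p.2).cluster u) fun _ => (1 : ℝ≥0∞)).symm

/-- **The switched covariance mass** `D(T) = Σ 1{∂p₁ = T}1{∂p₂ = ∅} w w 1{w ∉ C_{p₁+p₂}(u)}`
(`= Z[T]Z[∅] - Z[T Δ {u,w}]Z[{u,w}]` by the switching lemma, i.e. `Z[∅]² ∂⟨σ_{TΔ{u,w}}⟩/∂J_{uw}`).
[cite: CamiaJiangNewman2023, §2 eq. (21)–(22)] -/
def dmass (K : G.edgeFinset → ℝ) (u w : V) (T : Finset V) : ℝ≥0∞ :=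
  ∑' p : Current G × Current G, epairWeight K T ∅ p * (if w ∈ (p.1 + p.2).cluster u then 0 else 1)

/-- `D` is symmetric in `u, w`. [folklore] -/
theorem dmass_comm (K : G.edgeFinset → ℝ) (u w : V) (T : Finset V) : dmass K u w T = dmass K w u T := by
  unfold dmass
  refine tsum_congr fun p => ?_
  simp only [mem_cluster_comm (x := u) (v := w)]

/-- **A family of frozen clusters avoiding `w` is part of `D`**: `Σ_{A ∈ 𝓕} M_A(T) ≤ D(T)` if `w ∉ A` for
`A ∈ 𝓕`. [folklore] -/
theorem sum_pmass_le_dmass (K : G.edgeFinset → ℝ) (u w : V) (T : Finset V) {F : Finset (Finset V)}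
    (hF : ∀ A ∈ F, w ∉ A) : ∑ A ∈ F, pmass K u A T (fun _ => 1) ≤ dmass K u w T := by
  have hres := tsum_pair_mul_apply_cluster_eq_sum (fun p => epairWeight K T ∅ p)
    (fun C => if w ∈ C then 0 else 1) u
  change dmass K u w T = _ at hres
  rw [hres]
  calc ∑ A ∈ F, pmass K u A T (fun _ => 1)
      = ∑ A ∈ F, (∑' p : Current G × Current G, epairWeight K T ∅ p *
          (if (p.1 + p.2).cluster u = A then 1 else 0)) * (if w ∈ A then 0 else 1) := by
        refine Finset.sum_congr rfl fun A hA => ?_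
        rw [if_neg (hF A hA), mul_one]
        unfold pmass
        simp only [mul_one]
    _ ≤ _ := Finset.sum_le_sum_of_subset (Finset.subset_univ F)

/-! ### The per-vertex quantities -/

/-- The frozen clusters of type "`C(u) ∋ x` and `C(u)` avoids `w, y₁, y₂, y₃`". [folklore] -/
def fam (x y₁ y₂ y₃ u w : V) : Finset (Finset V) :=
  univ.filter fun A => u ∈ A ∧ x ∈ A ∧ w ∉ A ∧ y₁ ∉ A ∧ y₂ ∉ A ∧ y₃ ∉ A

omit [DecidableRel G.Adj] in
/-- Membership in `fam`. [folklore] -/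
theorem mem_fam {x y₁ y₂ y₃ u w : V} {A : Finset V} :
    A ∈ fam x y₁ y₂ y₃ u w ↔ u ∈ A ∧ x ∈ A ∧ w ∉ A ∧ y₁ ∉ A ∧ y₂ ∉ A ∧ y₃ ∉ A := by
  simp [fam]

/-- The mass of the configurations whose `u`-cluster has type `x`, weighted by `Φ`:
`Σ_{A ∈ fam} M^Φ_A({x,y₁,y₂,y₃,u,w})`. [folklore] -/
def fmass (K : G.edgeFinset → ℝ) (x y₁ y₂ y₃ u w : V) (Φ : Current G → ℝ≥0∞) : ℝ≥0∞ :=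
  ∑ A ∈ fam x y₁ y₂ y₃ u w, pmass K u A {x, y₁, y₂, y₃, u, w} Φ

/-- The conditioned right side for the type `x`:
`Σ_{A ∈ fam} (Z[{y₂,y₃}] M_A({x,y₁,u,w}) + Z[{y₁,y₃}] M_A({x,y₂,u,w}) + Z[{y₁,y₂}] M_A({x,y₃,u,w}))`. [folklore] -/
def rmass (K : G.edgeFinset → ℝ) (x y₁ y₂ y₃ u w : V) : ℝ≥0∞ :=
  ∑ A ∈ fam x y₁ y₂ y₃ u w,
    (ecurrentSum K {y₂, y₃} * pmass K u A {x, y₁, u, w} (fun _ => 1) +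
      ecurrentSum K {y₁, y₃} * pmass K u A {x, y₂, u, w} (fun _ => 1) +
      ecurrentSum K {y₁, y₂} * pmass K u A {x, y₃, u, w} (fun _ => 1))

/-- **The frozen-cluster inequality summed over the clusters of type `x`**:
`Z[∅] fmass(1) + 2 Z[∅] fmass(conn₃ w y₂ y₃) ≤ rmass`. [cite: AizenmanCMP1982, §5 (conditioning on clusters)] -/
theorem fmass_le_rmass (hK : ∀ e, 0 ≤ K e) {x y₁ y₂ y₃ u w : V}
    (hw₁ : w ≠ y₁) (hw₂ : w ≠ y₂) (hw₃ : w ≠ y₃) (h₁₂ : y₁ ≠ y₂) (h₁₃ : y₁ ≠ y₃) (h₂₃ : y₂ ≠ y₃) :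
    ecurrentSum K ∅ * fmass K x y₁ y₂ y₃ u w (fun _ => 1) +
        2 * (ecurrentSum K ∅ * fmass K x y₁ y₂ y₃ u w (conn₃ w y₂ y₃)) ≤ rmass K x y₁ y₂ y₃ u w := by
  unfold fmass rmass
  rw [Finset.mul_sum, Finset.mul_sum, Finset.mul_sum, ← Finset.sum_add_distrib]
  refine Finset.sum_le_sum fun A hA => ?_
  obtain ⟨hu, hx, hw, hy₁, hy₂, hy₃⟩ := mem_fam.1 hA
  exact frozen_cluster_inequality hK hx hu hw hy₁ hy₂ hy₃ hw₁ hw₂ hw₃ h₁₂ h₁₃ h₂₃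

/-! ### Parity: the type of a configuration -/

omit [Fintype V] [DecidableEq V] in
/-- The fifteen inequalities encoded by `[a,b,c,d,u,w].Nodup`. [folklore] -/
theorem nodup6 {a b c d u w : V} (h : [a, b, c, d, u, w].Nodup) :
    (a ≠ b ∧ a ≠ c ∧ a ≠ d ∧ a ≠ u ∧ a ≠ w) ∧ (b ≠ c ∧ b ≠ d ∧ b ≠ u ∧ b ≠ w) ∧ (c ≠ d ∧ c ≠ u ∧ c ≠ w) ∧
      (d ≠ u ∧ d ≠ w) ∧ u ≠ w := by
  simpa [List.nodup_cons] using h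

omit [Fintype V] [DecidableRel G.Adj] in
/-- `#((insert x s) ∩ C) = 𝟙[x ∈ C] + #(s ∩ C)` for `x ∉ s`. [folklore] -/
theorem card_insert_inter {x : V} {s C : Finset V} (hx : x ∉ s) :
    #(insert x s ∩ C) = (if x ∈ C then 1 else 0) + #(s ∩ C) := by
  by_cases hxC : x ∈ C
  · rw [Finset.insert_inter_of_mem hxC, Finset.card_insert_of_notMem (fun h => hx (Finset.mem_inter.1 h).1),
      if_pos hxC, add_comm]
  · rw [Finset.insert_inter_of_notMem hxC, if_neg hxC, zero_add]

omit [Fintype V] [DecidableRel G.Adj] in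
/-- `#({x} ∩ C) = 𝟙[x ∈ C]`. [folklore] -/
theorem card_singleton_inter' (x : V) (C : Finset V) : #({x} ∩ C) = (if x ∈ C then 1 else 0) := by
  by_cases hxC : x ∈ C
  · rw [Finset.singleton_inter_of_mem hxC, Finset.card_singleton, if_pos hxC]
  · rw [Finset.singleton_inter_of_notMem hxC, Finset.card_empty, if_neg hxC]

/-- **Handshake on a cluster, counted on the six sources**: for `∂m = {a,b,c,d,u,w}` (distinct) and any `z`, the
number of the six sources lying in `C_m(z)` is even. [cite: AizenmanDuminilCopinSidoraviciusCMP2015, §3.2, eq. (3.7)] -/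
theorem even_count_cluster {m : Current G} {a b c d u w : V} (hnd : [a, b, c, d, u, w].Nodup)
    (hs : m.sources = {a, b, c, d, u, w}) (z : V) :
    Even ((if a ∈ m.cluster z then 1 else 0) + ((if b ∈ m.cluster z then 1 else 0) +
      ((if c ∈ m.cluster z then 1 else 0) + ((if d ∈ m.cluster z then 1 else 0) +
      ((if u ∈ m.cluster z then 1 else 0) + (if w ∈ m.cluster z then 1 else 0)))))) := by
  have h := even_card_sources_cluster m z (m.cluster z) (fun v => mem_cluster_iff)
  obtain ⟨⟨hab, hac, had, hau, haw⟩, ⟨hbc, hbd, hbu, hbw⟩, ⟨hcd, hcu, hcw⟩, ⟨hdu, hdw⟩, huw⟩ := nodup6 hnd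
  rw [Finset.filter_mem_eq_inter, Finset.inter_comm, hs,
    card_insert_inter (by simp [hab, hac, had, hau, haw]), card_insert_inter (by simp [hbc, hbd, hbu, hbw]),
    card_insert_inter (by simp [hcd, hcu, hcw]), card_insert_inter (by simp [hdu, hdw]),
    card_insert_inter (by simp [huw]), card_singleton_inter'] at h
  exact h

/-- **The type of a configuration.**  If `∂m = {a,b,c,d,u,w}` (distinct) and `w ∉ C_m(u)`, then either
`C_m(u)` contains exactly one of `a,b,c,d` (four cases), or it contains exactly three of them, in which case the
cluster of `w` contains the fourth one and avoids `u` and the other three, which are connected to `u` (four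
cases). [cite: AizenmanDuminilCopinSidoraviciusCMP2015, §3.2, eq. (3.7)] -/
theorem cluster_types {m : Current G} {a b c d u w : V} (hnd : [a, b, c, d, u, w].Nodup)
    (hs : m.sources = {a, b, c, d, u, w}) (hwu : w ∉ m.cluster u) :
    m.cluster u ∈ fam a b c d u w ∨ m.cluster u ∈ fam b a c d u w ∨ m.cluster u ∈ fam c a b d u w ∨
      m.cluster u ∈ fam d a b c u w ∨
      (m.cluster w ∈ fam a b c d w u ∧ c ∈ m.cluster u ∧ d ∈ m.cluster c) ∨
      (m.cluster w ∈ fam b a c d w u ∧ c ∈ m.cluster u ∧ d ∈ m.cluster c) ∨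
      (m.cluster w ∈ fam c a b d w u ∧ b ∈ m.cluster u ∧ d ∈ m.cluster b) ∨
      (m.cluster w ∈ fam d a b c w u ∧ b ∈ m.cluster u ∧ c ∈ m.cluster b) := by
  have hU := even_count_cluster hnd hs u
  have hW := even_count_cluster hnd hs w
  have huu : u ∈ m.cluster u := mem_cluster_self m u
  have hww : w ∈ m.cluster w := mem_cluster_self m w
  have huw : u ∉ m.cluster w := fun h => hwu (mem_cluster_comm.1 h)
  -- a vertex of `C(u)` is not in `C(w)`; two vertices of `C(u)` are connected
  have notW : ∀ {x : V}, x ∈ m.cluster u → x ∉ m.cluster w := fun hx hxw =>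
    hwu (mem_cluster_trans hx (mem_cluster_comm.1 hxw))
  have conn : ∀ {x y : V}, x ∈ m.cluster u → y ∈ m.cluster u → y ∈ m.cluster x := fun hx hy =>
    mem_cluster_trans (mem_cluster_comm.1 hx) hy
  simp only [huu, hwu, if_true, if_false] at hU
  simp only [huw, hww, if_true, if_false] at hW
  by_cases ha : a ∈ m.cluster u <;> by_cases hb : b ∈ m.cluster u <;> by_cases hc : c ∈ m.cluster u <;>
    by_cases hd : d ∈ m.cluster u <;> simp only [ha, hb, hc, hd, if_true, if_false] at hU <;>
    (try exact absurd hU (by decide))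
  · -- d ∉ ; a b c ∈ : the cluster of `w` is of type `d`
    have haw := notW ha; have hbw := notW hb; have hcw := notW hc
    simp only [haw, hbw, hcw, if_false] at hW
    by_cases hdw : d ∈ m.cluster w
    · exact Or.inr (Or.inr (Or.inr (Or.inr (Or.inr (Or.inr (Or.inr
        ⟨mem_fam.2 ⟨hww, hdw, huw, haw, hbw, hcw⟩, hb, conn hb hc⟩))))))
    · simp only [hdw, if_false] at hW; exact absurd hW (by decide)
  · -- c ∉
    have haw := notW ha; have hbw := notW hb; have hdw := notW hd
    simp only [haw, hbw, hdw, if_false] at hW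
    by_cases hcw : c ∈ m.cluster w
    · exact Or.inr (Or.inr (Or.inr (Or.inr (Or.inr (Or.inr (Or.inl
        ⟨mem_fam.2 ⟨hww, hcw, huw, haw, hbw, hdw⟩, hb, conn hb hd⟩))))))
    · simp only [hcw, if_false] at hW; exact absurd hW (by decide)
  · -- b ∉
    have haw := notW ha; have hcw := notW hc; have hdw := notW hd
    simp only [haw, hcw, hdw, if_false] at hW
    by_cases hbw : b ∈ m.cluster w
    · exact Or.inr (Or.inr (Or.inr (Or.inr (Or.inr (Or.inl ⟨mem_fam.2 ⟨hww, hbw, huw, haw, hcw, hdw⟩, hc, conn hc hd⟩)))))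
    · simp only [hbw, if_false] at hW; exact absurd hW (by decide)
  · -- a only
    exact Or.inl (mem_fam.2 ⟨huu, ha, hwu, hb, hc, hd⟩)
  · -- a ∉ ; b c d ∈
    have hbw := notW hb; have hcw := notW hc; have hdw := notW hd
    simp only [hbw, hcw, hdw, if_false] at hW
    by_cases haw : a ∈ m.cluster w
    · exact Or.inr (Or.inr (Or.inr (Or.inr (Or.inl ⟨mem_fam.2 ⟨hww, haw, huw, hbw, hcw, hdw⟩, hc, conn hc hd⟩))))
    · simp only [haw, if_false] at hW; exact absurd hW (by decide)
  · -- b only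
    exact Or.inr (Or.inl (mem_fam.2 ⟨huu, hb, hwu, ha, hc, hd⟩))
  · -- c only
    exact Or.inr (Or.inr (Or.inl (mem_fam.2 ⟨huu, hc, hwu, ha, hb, hd⟩)))
  · -- d only
    exact Or.inr (Or.inr (Or.inr (Or.inl (mem_fam.2 ⟨huu, hd, hwu, ha, hb, hc⟩))))

/-! ### The left side is dominated by the type-`x` masses and the mirror connected masses -/

/-- `fmass` as a single pair sum. [folklore] -/
theorem fmass_eq_tsum (K : G.edgeFinset → ℝ) (x y₁ y₂ y₃ u w : V) (Φ : Current G → ℝ≥0∞) :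
    fmass K x y₁ y₂ y₃ u w Φ = ∑' p : Current G × Current G, epairWeight K {x, y₁, y₂, y₃, u, w} ∅ p *
      ((if (p.1 + p.2).cluster u ∈ fam x y₁ y₂ y₃ u w then 1 else 0) * Φ (p.1 + p.2)) := by
  have h := tsum_pair_mul_ite_mem_eq_sum (fun p => epairWeight K {x, y₁, y₂, y₃, u, w} ∅ p)
    (fun p => Φ (p.1 + p.2)) u (fam x y₁ y₂ y₃ u w)
  simp only [mul_assoc] at h
  unfold fmass pmass
  simp only [mul_assoc]
  exact h.symm

/-- **Domination of the left side** (the parity step): with `T = {a,b,c,d,u,w}`,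
`Z[∅] D(T) ≤ Z[∅] Σ_x fmass_x(1) + Z[∅] Σ_x fmass'_x(conn₃ u ··)`, where `fmass_x` freezes the cluster of `u`
(type `x`) and `fmass'_x` freezes the cluster of `w` (type `x`, roles of `u, w` exchanged) with the weight
"the other three are connected to `u`". [cite: CamiaJiangNewman2023, Thm 1 (case k = 2)] -/
theorem dmass_le_fmass (K : G.edgeFinset → ℝ) {a b c d u w : V} (hnd : [a, b, c, d, u, w].Nodup) :
    ecurrentSum K ∅ * dmass K u w {a, b, c, d, u, w} ≤
      ecurrentSum K ∅ * (fmass K a b c d u w (fun _ => 1) + fmass K b a c d u w (fun _ => 1) +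
          fmass K c a b d u w (fun _ => 1) + fmass K d a b c u w (fun _ => 1)) +
        ecurrentSum K ∅ * (fmass K a b c d w u (conn₃ u c d) + fmass K b a c d w u (conn₃ u c d) +
          fmass K c a b d w u (conn₃ u b d) + fmass K d a b c w u (conn₃ u b c)) := by
  set T : Finset V := {a, b, c, d, u, w} with hT
  have e₁ : ({b, a, c, d, u, w} : Finset V) = T := by
    ext v; simp only [hT, Finset.mem_insert, Finset.mem_singleton]; tauto
  have e₂ : ({c, a, b, d, u, w} : Finset V) = T := by
    ext v; simp only [hT, Finset.mem_insert, Finset.mem_singleton]; tauto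
  have e₃ : ({d, a, b, c, u, w} : Finset V) = T := by
    ext v; simp only [hT, Finset.mem_insert, Finset.mem_singleton]; tauto
  have e₄ : ({a, b, c, d, w, u} : Finset V) = T := by
    ext v; simp only [hT, Finset.mem_insert, Finset.mem_singleton]; tauto
  have e₅ : ({b, a, c, d, w, u} : Finset V) = T := by
    ext v; simp only [hT, Finset.mem_insert, Finset.mem_singleton]; tauto
  have e₆ : ({c, a, b, d, w, u} : Finset V) = T := by
    ext v; simp only [hT, Finset.mem_insert, Finset.mem_singleton]; tauto
  have e₇ : ({d, a, b, c, w, u} : Finset V) = T := by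
    ext v; simp only [hT, Finset.mem_insert, Finset.mem_singleton]; tauto
  rw [fmass_eq_tsum, fmass_eq_tsum, fmass_eq_tsum, fmass_eq_tsum, fmass_eq_tsum, fmass_eq_tsum, fmass_eq_tsum,
    fmass_eq_tsum, e₁, e₂, e₃, e₄, e₅, e₆, e₇, ← hT]
  rw [← ENNReal.tsum_add, ← ENNReal.tsum_add, ← ENNReal.tsum_add, ← ENNReal.tsum_add, ← ENNReal.tsum_add,
    ← ENNReal.tsum_add, ← mul_add, ← ENNReal.tsum_add]
  unfold dmass
  refine mul_le_mul' le_rfl (ENNReal.tsum_le_tsum fun p => ?_)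
  simp only [← mul_add]
  by_cases hp : p.1.sources = T ∧ p.2.sources = ∅
  swap
  · simp [epairWeight, hp]
  refine mul_le_mul' le_rfl ?_
  have hs : (p.1 + p.2).sources = {a, b, c, d, u, w} := by
    rw [sources_add, hp.1, hp.2, ← Finset.bot_eq_empty, symmDiff_bot, hT]
  by_cases hwC : w ∈ (p.1 + p.2).cluster u
  · rw [if_pos hwC]; exact bot_le
  rw [if_neg hwC]
  rcases cluster_types hnd hs hwC with h | h | h | h | ⟨h, h1, h2⟩ | ⟨h, h1, h2⟩ | ⟨h, h1, h2⟩ | ⟨h, h1, h2⟩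
  · have h1 : (1 : ℝ≥0∞) ≤ (if (p.1 + p.2).cluster u ∈ fam a b c d u w then 1 else 0) * 1 := by simp [h]
    exact h1.trans (le_add_right (le_add_right (le_add_right (le_add_right le_rfl))))
  · have h1 : (1 : ℝ≥0∞) ≤ (if (p.1 + p.2).cluster u ∈ fam b a c d u w then 1 else 0) * 1 := by simp [h]
    exact h1.trans (le_add_right (le_add_right (le_add_right (le_add_left le_rfl))))
  · have h1 : (1 : ℝ≥0∞) ≤ (if (p.1 + p.2).cluster u ∈ fam c a b d u w then 1 else 0) * 1 := by simp [h]
    exact h1.trans (le_add_right (le_add_right (le_add_left le_rfl)))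
  · have h1 : (1 : ℝ≥0∞) ≤ (if (p.1 + p.2).cluster u ∈ fam d a b c u w then 1 else 0) * 1 := by simp [h]
    exact h1.trans (le_add_right (le_add_left le_rfl))
  · have h3 : (1 : ℝ≥0∞) ≤ (if (p.1 + p.2).cluster w ∈ fam a b c d w u then 1 else 0) * conn₃ u c d (p.1 + p.2) := by
      simp [conn₃, h, h1, h2]
    exact h3.trans (le_add_left (le_add_right (le_add_right (le_add_right le_rfl))))
  · have h3 : (1 : ℝ≥0∞) ≤ (if (p.1 + p.2).cluster w ∈ fam b a c d w u then 1 else 0) * conn₃ u c d (p.1 + p.2) := by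
      simp [conn₃, h, h1, h2]
    exact h3.trans (le_add_left (le_add_right (le_add_right (le_add_left le_rfl))))
  · have h3 : (1 : ℝ≥0∞) ≤ (if (p.1 + p.2).cluster w ∈ fam c a b d w u then 1 else 0) * conn₃ u b d (p.1 + p.2) := by
      simp [conn₃, h, h1, h2]
    exact h3.trans (le_add_left (le_add_right (le_add_left le_rfl)))
  · have h3 : (1 : ℝ≥0∞) ≤ (if (p.1 + p.2).cluster w ∈ fam d a b c w u then 1 else 0) * conn₃ u b c (p.1 + p.2) := by
      simp [conn₃, h, h1, h2]
    exact h3.trans (le_add_left (le_add_left le_rfl))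

/-! ### The conditioned right sides are part of the right side -/

/-- Two disjoint families of frozen clusters avoiding `w` are part of `D`. [folklore] -/
theorem sum_pmass_add_le_dmass (K : G.edgeFinset → ℝ) (u w : V) (T : Finset V) {F₁ F₂ : Finset (Finset V)}
    (h₁ : ∀ A ∈ F₁, w ∉ A) (h₂ : ∀ A ∈ F₂, w ∉ A) (hd : Disjoint F₁ F₂) :
    ∑ A ∈ F₁, pmass K u A T (fun _ => 1) + ∑ A ∈ F₂, pmass K u A T (fun _ => 1) ≤ dmass K u w T := by
  rw [← Finset.sum_union hd]
  exact sum_pmass_le_dmass K u w T fun A hA => (Finset.mem_union.1 hA).elim (h₁ A) (h₂ A)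

omit [DecidableRel G.Adj] in
/-- The clusters of `fam` avoid `w`. [folklore] -/
theorem not_mem_of_mem_fam {x y₁ y₂ y₃ u w : V} : ∀ A ∈ fam x y₁ y₂ y₃ u w, w ∉ A :=
  fun _ hA => (mem_fam.1 hA).2.2.1

/-- **The four conditioned right sides are dominated by the right side**:
`Σ_x rmass_x ≤ Σ_{S} Z[X∖S] D(S ∪ {u,w})` — each of the six pairs `S = {x,y}` receives the clusters of type `x`
and of type `y`, two disjoint families avoiding `w`. [cite: CamiaJiangNewman2023, Thm 1 (case k = 2)] -/
theorem rmass_sum_le (K : G.edgeFinset → ℝ) (a b c d u w : V) :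
    rmass K a b c d u w + rmass K b a c d u w + rmass K c a b d u w + rmass K d a b c u w ≤
      ecurrentSum K {c, d} * dmass K u w {a, b, u, w} + ecurrentSum K {b, d} * dmass K u w {a, c, u, w} +
        ecurrentSum K {b, c} * dmass K u w {a, d, u, w} + ecurrentSum K {a, d} * dmass K u w {b, c, u, w} +
        ecurrentSum K {a, c} * dmass K u w {b, d, u, w} + ecurrentSum K {a, b} * dmass K u w {c, d, u, w} := by
  unfold rmass
  simp only [Finset.sum_add_distrib, ← Finset.mul_sum]
  rw [Finset.insert_comm b a {u, w}, Finset.insert_comm c a {u, w}, Finset.insert_comm c b {u, w},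
    Finset.insert_comm d a {u, w}, Finset.insert_comm d b {u, w}, Finset.insert_comm d c {u, w}]
  set fa := fam a b c d u w
  set fb := fam b a c d u w
  set fc := fam c a b d u w
  set fd := fam d a b c u w
  have hab : Disjoint fa fb := Finset.disjoint_left.2 fun A h1 h2 => (mem_fam.1 h1).2.2.2.1 (mem_fam.1 h2).2.1
  have hac : Disjoint fa fc := Finset.disjoint_left.2 fun A h1 h2 => (mem_fam.1 h1).2.2.2.2.1 (mem_fam.1 h2).2.1
  have had : Disjoint fa fd := Finset.disjoint_left.2 fun A h1 h2 => (mem_fam.1 h1).2.2.2.2.2 (mem_fam.1 h2).2.1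
  have hbc : Disjoint fb fc := Finset.disjoint_left.2 fun A h1 h2 => (mem_fam.1 h1).2.2.2.2.1 (mem_fam.1 h2).2.1
  have hbd : Disjoint fb fd := Finset.disjoint_left.2 fun A h1 h2 => (mem_fam.1 h1).2.2.2.2.2 (mem_fam.1 h2).2.1
  have hcd : Disjoint fc fd := Finset.disjoint_left.2 fun A h1 h2 => (mem_fam.1 h1).2.2.2.2.2 (mem_fam.1 h2).2.1
  calc ecurrentSum K {c, d} * ∑ A ∈ fa, pmass K u A {a, b, u, w} (fun _ => 1) +
          ecurrentSum K {b, d} * ∑ A ∈ fa, pmass K u A {a, c, u, w} (fun _ => 1) +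
          ecurrentSum K {b, c} * ∑ A ∈ fa, pmass K u A {a, d, u, w} (fun _ => 1) +
        (ecurrentSum K {c, d} * ∑ A ∈ fb, pmass K u A {a, b, u, w} (fun _ => 1) +
          ecurrentSum K {a, d} * ∑ A ∈ fb, pmass K u A {b, c, u, w} (fun _ => 1) +
          ecurrentSum K {a, c} * ∑ A ∈ fb, pmass K u A {b, d, u, w} (fun _ => 1)) +
        (ecurrentSum K {b, d} * ∑ A ∈ fc, pmass K u A {a, c, u, w} (fun _ => 1) +
          ecurrentSum K {a, d} * ∑ A ∈ fc, pmass K u A {b, c, u, w} (fun _ => 1) +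
          ecurrentSum K {a, b} * ∑ A ∈ fc, pmass K u A {c, d, u, w} (fun _ => 1)) +
        (ecurrentSum K {b, c} * ∑ A ∈ fd, pmass K u A {a, d, u, w} (fun _ => 1) +
          ecurrentSum K {a, c} * ∑ A ∈ fd, pmass K u A {b, d, u, w} (fun _ => 1) +
          ecurrentSum K {a, b} * ∑ A ∈ fd, pmass K u A {c, d, u, w} (fun _ => 1))
      = ecurrentSum K {c, d} * (∑ A ∈ fa, pmass K u A {a, b, u, w} (fun _ => 1) +
            ∑ A ∈ fb, pmass K u A {a, b, u, w} (fun _ => 1)) +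
          ecurrentSum K {b, d} * (∑ A ∈ fa, pmass K u A {a, c, u, w} (fun _ => 1) +
            ∑ A ∈ fc, pmass K u A {a, c, u, w} (fun _ => 1)) +
          ecurrentSum K {b, c} * (∑ A ∈ fa, pmass K u A {a, d, u, w} (fun _ => 1) +
            ∑ A ∈ fd, pmass K u A {a, d, u, w} (fun _ => 1)) +
          ecurrentSum K {a, d} * (∑ A ∈ fb, pmass K u A {b, c, u, w} (fun _ => 1) +
            ∑ A ∈ fc, pmass K u A {b, c, u, w} (fun _ => 1)) +
          ecurrentSum K {a, c} * (∑ A ∈ fb, pmass K u A {b, d, u, w} (fun _ => 1) +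
            ∑ A ∈ fd, pmass K u A {b, d, u, w} (fun _ => 1)) +
          ecurrentSum K {a, b} * (∑ A ∈ fc, pmass K u A {c, d, u, w} (fun _ => 1) +
            ∑ A ∈ fd, pmass K u A {c, d, u, w} (fun _ => 1)) := by ring
    _ ≤ _ := by
        gcongr
        · exact sum_pmass_add_le_dmass K u w _ not_mem_of_mem_fam not_mem_of_mem_fam hab
        · exact sum_pmass_add_le_dmass K u w _ not_mem_of_mem_fam not_mem_of_mem_fam hac
        · exact sum_pmass_add_le_dmass K u w _ not_mem_of_mem_fam not_mem_of_mem_fam had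
        · exact sum_pmass_add_le_dmass K u w _ not_mem_of_mem_fam not_mem_of_mem_fam hbc
        · exact sum_pmass_add_le_dmass K u w _ not_mem_of_mem_fam not_mem_of_mem_fam hbd
        · exact sum_pmass_add_le_dmass K u w _ not_mem_of_mem_fam not_mem_of_mem_fam hcd

/-! ### The inequality -/

/-- **The current-sum inequality behind CJN Theorem 1 for `k = 2`.**  For couplings `K ≥ 0` on a finite simple
graph and six distinct vertices `a b c d u w`, with
`D(T) = Σ 1{∂n₁ = T} 1{∂n₂ = ∅} w w 1{w ∉ C_{n₁+n₂}(u)}` (`= Z[T]Z[∅] - Z[T Δ {u,w}]Z[{u,w}]`):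
`Z[∅] D({a,b,c,d,u,w}) ≤ Z[{c,d}]D({a,b,u,w}) + Z[{b,d}]D({a,c,u,w}) + Z[{b,c}]D({a,d,u,w})
                        + Z[{a,d}]D({b,c,u,w}) + Z[{a,c}]D({b,d,u,w}) + Z[{a,b}]D({c,d,u,w})`,
i.e. `∂⟨σ_aσ_bσ_cσ_d⟩/∂J_{uw} ≤ Σ_{S} ⟨σ_{X∖S}⟩ ∂⟨σ_S⟩/∂J_{uw}`, i.e. `-∂u₄(a,b,c,d)/∂J_{uw} ≥ 0` (CJN Thm 1,
`k = 2`, distinct sites away from `u, w`).  Proof: `2·LHS ≤ (T_u + B_w) + (T_w + B_u)` (`dmass_le_fmass` and its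
mirror), `T_u + 2B_u ≤ R_u ≤ RHS` (`fmass_le_rmass`, `rmass_sum_le`) and the mirror.
[cite: CamiaJiangNewman2023, Thm 1 (case k = 2)] -/
theorem ursellTwo_currentSum_inequality (hK : ∀ e, 0 ≤ K e) {a b c d u w : V} (hnd : [a, b, c, d, u, w].Nodup) :
    ecurrentSum K ∅ * dmass K u w {a, b, c, d, u, w} ≤
      ecurrentSum K {c, d} * dmass K u w {a, b, u, w} + ecurrentSum K {b, d} * dmass K u w {a, c, u, w} +
        ecurrentSum K {b, c} * dmass K u w {a, d, u, w} + ecurrentSum K {a, d} * dmass K u w {b, c, u, w} +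
        ecurrentSum K {a, c} * dmass K u w {b, d, u, w} + ecurrentSum K {a, b} * dmass K u w {c, d, u, w} := by
  obtain ⟨⟨hab, hac, had, hau, haw⟩, ⟨hbc, hbd, hbu, hbw⟩, ⟨hcd, hcu, hcw⟩, ⟨hdu, hdw⟩, huw⟩ := nodup6 hnd
  have hnd' : [a, b, c, d, w, u].Nodup := by
    simp [List.nodup_cons, hab, hac, had, hau, haw, hbc, hbd, hbu, hbw, hcd, hcu, hcw, hdu, hdw, huw.symm]
  -- notation
  set Z₀ := ecurrentSum K ∅ with hZ₀
  set LHS := Z₀ * dmass K u w {a, b, c, d, u, w} with hLHS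
  set RHS := ecurrentSum K {c, d} * dmass K u w {a, b, u, w} + ecurrentSum K {b, d} * dmass K u w {a, c, u, w} +
    ecurrentSum K {b, c} * dmass K u w {a, d, u, w} + ecurrentSum K {a, d} * dmass K u w {b, c, u, w} +
    ecurrentSum K {a, c} * dmass K u w {b, d, u, w} + ecurrentSum K {a, b} * dmass K u w {c, d, u, w} with hRHS
  set Fu := fmass K a b c d u w (fun _ => 1) + fmass K b a c d u w (fun _ => 1) +
    fmass K c a b d u w (fun _ => 1) + fmass K d a b c u w (fun _ => 1) with hFu
  set Fw := fmass K a b c d w u (fun _ => 1) + fmass K b a c d w u (fun _ => 1) +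
    fmass K c a b d w u (fun _ => 1) + fmass K d a b c w u (fun _ => 1) with hFw
  set Bu := fmass K a b c d u w (conn₃ w c d) + fmass K b a c d u w (conn₃ w c d) +
    fmass K c a b d u w (conn₃ w b d) + fmass K d a b c u w (conn₃ w b c) with hBu
  set Bw := fmass K a b c d w u (conn₃ u c d) + fmass K b a c d w u (conn₃ u c d) +
    fmass K c a b d w u (conn₃ u b d) + fmass K d a b c w u (conn₃ u b c) with hBw
  set Ru := rmass K a b c d u w + rmass K b a c d u w + rmass K c a b d u w + rmass K d a b c u w with hRu
  set Rw := rmass K a b c d w u + rmass K b a c d w u + rmass K c a b d w u + rmass K d a b c w u with hRw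
  -- the two dominations of the left side
  have hL1 : LHS ≤ Z₀ * Fu + Z₀ * Bw := dmass_le_fmass K hnd
  have hL2 : LHS ≤ Z₀ * Fw + Z₀ * Bu := by
    have h := dmass_le_fmass K hnd'
    have e : ({a, b, c, d, w, u} : Finset V) = {a, b, c, d, u, w} := by
      ext v; simp only [Finset.mem_insert, Finset.mem_singleton]; tauto
    rwa [e, dmass_comm K w u] at h
  -- the conditioned inequalities
  have hU : Z₀ * Fu + 2 * (Z₀ * Bu) ≤ Ru := by
    have h1 := fmass_le_rmass hK (x := a) (u := u) hbw.symm hcw.symm hdw.symm hbc hbd hcd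
    have h2 := fmass_le_rmass hK (x := b) (u := u) haw.symm hcw.symm hdw.symm hac had hcd
    have h3 := fmass_le_rmass hK (x := c) (u := u) haw.symm hbw.symm hdw.symm hab had hbd
    have h4 := fmass_le_rmass hK (x := d) (u := u) haw.symm hbw.symm hcw.symm hab hac hbc
    calc Z₀ * Fu + 2 * (Z₀ * Bu)
        = (Z₀ * fmass K a b c d u w (fun _ => 1) + 2 * (Z₀ * fmass K a b c d u w (conn₃ w c d))) +
          (Z₀ * fmass K b a c d u w (fun _ => 1) + 2 * (Z₀ * fmass K b a c d u w (conn₃ w c d))) +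
          (Z₀ * fmass K c a b d u w (fun _ => 1) + 2 * (Z₀ * fmass K c a b d u w (conn₃ w b d))) +
          (Z₀ * fmass K d a b c u w (fun _ => 1) + 2 * (Z₀ * fmass K d a b c u w (conn₃ w b c))) := by
            simp only [hFu, hBu]; ring
      _ ≤ Ru := add_le_add (add_le_add (add_le_add h1 h2) h3) h4
  have hW : Z₀ * Fw + 2 * (Z₀ * Bw) ≤ Rw := by
    have h1 := fmass_le_rmass hK (x := a) (u := w) hbu.symm hcu.symm hdu.symm hbc hbd hcd
    have h2 := fmass_le_rmass hK (x := b) (u := w) hau.symm hcu.symm hdu.symm hac had hcd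
    have h3 := fmass_le_rmass hK (x := c) (u := w) hau.symm hbu.symm hdu.symm hab had hbd
    have h4 := fmass_le_rmass hK (x := d) (u := w) hau.symm hbu.symm hcu.symm hab hac hbc
    calc Z₀ * Fw + 2 * (Z₀ * Bw)
        = (Z₀ * fmass K a b c d w u (fun _ => 1) + 2 * (Z₀ * fmass K a b c d w u (conn₃ u c d))) +
          (Z₀ * fmass K b a c d w u (fun _ => 1) + 2 * (Z₀ * fmass K b a c d w u (conn₃ u c d))) +
          (Z₀ * fmass K c a b d w u (fun _ => 1) + 2 * (Z₀ * fmass K c a b d w u (conn₃ u b d))) +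
          (Z₀ * fmass K d a b c w u (fun _ => 1) + 2 * (Z₀ * fmass K d a b c w u (conn₃ u b c))) := by
            simp only [hFw, hBw]; ring
      _ ≤ Rw := add_le_add (add_le_add (add_le_add h1 h2) h3) h4
  -- the right sides
  have hRu : Ru ≤ RHS := rmass_sum_le K a b c d u w
  have hRw : Rw ≤ RHS := by
    have h := rmass_sum_le K a b c d w u
    simp only [dmass_comm K w u, Finset.pair_comm w u] at h
    exact h
  -- assemble: `2 LHS ≤ 2 RHS`
  have h2 : 2 * LHS ≤ 2 * RHS :=
    calc 2 * LHS = LHS + LHS := two_mul LHS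
      _ ≤ (Z₀ * Fu + Z₀ * Bw) + (Z₀ * Fw + Z₀ * Bu) := add_le_add hL1 hL2
      _ = (Z₀ * Fu + 1 * (Z₀ * Bu)) + (Z₀ * Fw + 1 * (Z₀ * Bw)) := by ring
      _ ≤ (Z₀ * Fu + 2 * (Z₀ * Bu)) + (Z₀ * Fw + 2 * (Z₀ * Bw)) := by
          gcongr <;> exact one_le_two
      _ ≤ Ru + Rw := add_le_add hU hW
      _ ≤ RHS + RHS := add_le_add hRu hRw
      _ = 2 * RHS := (two_mul RHS).symm
  exact (ENNReal.mul_le_mul_iff_right two_ne_zero ENNReal.ofNat_ne_top).1 h2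

end Current

/-! ## Part II — from double currents to the pair-interaction average and to `u₄` -/

/-! ### The switched covariance mass in real terms -/

namespace Current

variable {K : G.edgeFinset → ℝ}

/-- **The switching lemma for `D`**: `D(T) + Z[T Δ {u,w}] Z[{u,w}] = Z[T] Z[∅]`.
[cite: CamiaJiangNewman2023, §2 eq. (21)–(22)] -/
theorem dmass_add_eq (hK : ∀ e, 0 ≤ K e) (u w : V) (T : Finset V) :
    dmass K u w T + ecurrentSum K (T ∆ ({u} ∆ {w})) * ecurrentSum K ({u} ∆ {w}) =
      ecurrentSum K T * ecurrentSum K ∅ := by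
  have hsw := tsum_epairWeight_switch_pair hK T u w (fun _ => 1)
  simp only [one_mul, mul_one] at hsw
  rw [← tsum_epairWeight, hsw, ← tsum_epairWeight, dmass, ← ENNReal.tsum_add]
  refine tsum_congr fun p => ?_
  rw [← mul_add]
  by_cases h : w ∈ (p.1 + p.2).cluster u <;> simp [h]

/-- `D(T) ≤ Z[T] Z[∅] < ∞`. [folklore] -/
theorem dmass_ne_top (hK : ∀ e, 0 ≤ K e) (u w : V) (T : Finset V) : dmass K u w T ≠ ∞ :=
  ne_top_of_le_ne_top (ENNReal.mul_ne_top (ecurrentSum_ne_top hK T) (ecurrentSum_ne_top hK ∅))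
    ((dmass_add_eq hK u w T) ▸ le_self_add)

/-- **Real form**: `D(T) = Z[T]Z[∅] - Z[T Δ {u,w}]Z[{u,w}]` with the real current sums `wcurrentSum`.
[cite: CamiaJiangNewman2023, §2 eq. (21)–(22)] -/
theorem toReal_dmass (hK : ∀ e, 0 ≤ K e) (u w : V) (T : Finset V) :
    (dmass K u w T).toReal =
      wcurrentSum K T * wcurrentSum K ∅ - wcurrentSum K (T ∆ ({u} ∆ {w})) * wcurrentSum K ({u} ∆ {w}) := by
  have h := congrArg ENNReal.toReal (dmass_add_eq hK u w T)
  rw [ENNReal.toReal_add (dmass_ne_top hK u w T) (ENNReal.mul_ne_top (ecurrentSum_ne_top hK _) (ecurrentSum_ne_top hK _)),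
    ENNReal.toReal_mul, ENNReal.toReal_mul, toReal_ecurrentSum hK, toReal_ecurrentSum hK, toReal_ecurrentSum hK,
    toReal_ecurrentSum hK] at h
  linarith

end Current

/-! ### The pair-interaction average as random-current ratios on the complete graph -/

namespace PairIsing

variable {ι : Type*} [Fintype ι] [DecidableEq ι]

/-- The couplings `K_{{a,b}} = c_{a,b} + c_{b,a}` on the complete graph induced by the coupling matrix `c`
(`pairEdgeWeight c 2`). [folklore] -/
abbrev edgeK (c : ι → ι → ℝ) : (⊤ : SimpleGraph ι).edgeFinset → ℝ := pairEdgeWeight c 2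

/-- `edgeK c ≥ 0` for `c ≥ 0`. [folklore] -/
theorem edgeK_nonneg {c : ι → ι → ℝ} (hc : ∀ a b, 0 ≤ c a b) : ∀ e, 0 ≤ edgeK c e :=
  pairEdgeWeight_nonneg zero_le_two hc

/-- **The dictionary**: `⟨σ_A⟩_c = Z_K[A]/Z_K[∅]` with `K = pairEdgeWeight c 2` on the complete graph
(`PairIsing.weight c σ = exp(Σ_{a,b} c_{a,b}σ_aσ_b) = exp((2/2)Σ…)`). [cite: Panis2023Triviality, §4.1] -/
theorem avg_spinProduct_eq_div {c : ι → ι → ℝ} (hc : ∀ a b, 0 ≤ c a b) (A : Finset ι) :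
    avg c (spinProduct A) = wcurrentSum (edgeK c) A / wcurrentSum (edgeK c) ∅ := by
  have h := pairGibbs_spinProduct_eq_wcurrentSum_div (zero_le_two (α := ℝ)) hc A
  have hw : ∀ σ : SpinConfig ι, Real.exp (2 / 2 * ∑ a, ∑ b, c a b * spinAt a σ * spinAt b σ) = weight c σ := by
    intro σ
    rw [weight, show (2 : ℝ) / 2 = 1 by norm_num, one_mul]
    simp only [mul_assoc]
  simp only [hw] at h
  rw [avg_def]
  exact h

/-- `Z_K[∅] > 0` (real). [folklore] -/
theorem wcurrentSum_edgeK_empty_pos {c : ι → ι → ℝ} (hc : ∀ a b, 0 ≤ c a b) : 0 < wcurrentSum (edgeK c) ∅ :=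
  wcurrentSum_empty_pos (edgeK_nonneg hc)

omit [Fintype ι] in
/-- `(A ∪ {u,w}) Δ ({u} Δ {w}) = A` for `u ≠ w` not in `A`. [folklore] -/
theorem union_pair_symmDiff {A : Finset ι} {u w : ι} (hu : u ∉ A) (hw : w ∉ A) (huw : u ≠ w) :
    (A ∪ {u, w}) ∆ ({u} ∆ {w}) = A := by
  rw [Current.symmDiff_singleton_eq_pair huw]
  ext v
  simp only [Finset.mem_symmDiff, Finset.mem_union, Finset.mem_insert, Finset.mem_singleton]
  constructor
  · rintro (⟨h1, h2⟩ | ⟨h1, h2⟩)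
    · tauto
    · exact absurd (Or.inr h1) h2
  · intro hv
    refine Or.inl ⟨Or.inl hv, ?_⟩
    rintro (rfl | rfl)
    · exact hu hv
    · exact hw hv

/-- **The covariance as a switched double-current mass**: for `u ≠ w` not in `A`,
`⟨σ_Aσ_uσ_w⟩ - ⟨σ_A⟩⟨σ_uσ_w⟩ = D(A ∪ {u,w}) / Z[∅]²`. [cite: CamiaJiangNewman2023, §2 eq. (21)–(22)] -/
theorem cov_eq_dmass_div {c : ι → ι → ℝ} (hc : ∀ a b, 0 ≤ c a b) {A : Finset ι} {u w : ι} (hu : u ∉ A)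
    (hw : w ∉ A) (huw : u ≠ w) :
    avg c (spinProduct (A ∪ {u, w})) - avg c (spinProduct A) * avg c (spinProduct {u, w}) =
      (Current.dmass (edgeK c) u w (A ∪ {u, w})).toReal / wcurrentSum (edgeK c) ∅ ^ 2 := by
  have hZ := wcurrentSum_edgeK_empty_pos hc
  rw [avg_spinProduct_eq_div hc, avg_spinProduct_eq_div hc, avg_spinProduct_eq_div hc,
    Current.toReal_dmass (edgeK_nonneg hc), union_pair_symmDiff hu hw huw, Current.symmDiff_singleton_eq_pair huw]
  field_simp

/-! ### `u₄` in terms of moments -/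

/-- **The Ursell function of four spins**: since odd moments vanish (spin flip),
`u₄(σ_{j0},σ_{j1},σ_{j2},σ_{j3}) = ⟨σσσσ⟩ - ⟨σ_{j0}σ_{j1}⟩⟨σ_{j2}σ_{j3}⟩ - ⟨σ_{j0}σ_{j2}⟩⟨σ_{j1}σ_{j3}⟩ - ⟨σ_{j0}σ_{j3}⟩⟨σ_{j1}σ_{j2}⟩`
for EVERY coupling matrix `c` and every `j : Fin 4 → ι` (block recursion of the Möbius inversion at the index `0`).
[cite: CamiaJiangNewman2023, §1.1 eq. (2) and Remark 1] -/
theorem ursell_four_eq (c : ι → ι → ℝ) (j : Fin 4 → ι) :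
    ursell c j = avg c (fun σ => spinAt (j 0) σ * spinAt (j 1) σ * spinAt (j 2) σ * spinAt (j 3) σ) -
      avg c (fun σ => spinAt (j 0) σ * spinAt (j 1) σ) * avg c (fun σ => spinAt (j 2) σ * spinAt (j 3) σ) -
      avg c (fun σ => spinAt (j 0) σ * spinAt (j 2) σ) * avg c (fun σ => spinAt (j 1) σ * spinAt (j 3) σ) -
      avg c (fun σ => spinAt (j 0) σ * spinAt (j 3) σ) * avg c (fun σ => spinAt (j 1) σ * spinAt (j 2) σ) := by
  set m : Finset (Fin 4) → ℝ := fun B => avg c (fun σ => ∏ i ∈ B, spinAt (j i) σ) with hm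
  have hm0 : m ∅ = 1 := by simp [hm, avg_const]
  have hodd : ∀ B : Finset (Fin 4), Odd B.card → m B = 0 := fun B hB => avg_prod_spinAt_eq_zero_of_odd c B j hB
  -- `ursell = ursellOf m univ`
  have hU : ursell c j = ursellOf m univ := by
    rw [ursellOf_univ_eq_sum_finpartition m hm0 (by norm_num)]
    rfl
  -- singletons and triples vanish, pairs are moments
  have h1 : ∀ i : Fin 4, m {i} = 0 := fun i => hodd {i} (by simp)
  have hpair : ∀ {p q : Fin 4}, p ≠ q → ursellOf m {p, q} = m {p, q} := fun {p q} hpq => by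
    rw [ursellOf_pair m hm0 hpq, h1, h1, mul_zero, sub_zero]
  have hu012 : ursellOf m {0, 1, 2} = 0 := by
    have h := sum_ursellOf_mul_eq m hm0 (show (0 : Fin 4) ∈ ({0, 1, 2} : Finset (Fin 4)) by decide)
    rw [show (({0, 1, 2} : Finset (Fin 4)).powerset.filter fun P => (0 : Fin 4) ∈ P) =
        {{0}, {0, 1}, {0, 2}, {0, 1, 2}} by decide,
      Finset.sum_insert (by decide), Finset.sum_insert (by decide), Finset.sum_pair (by decide),
      show ({0, 1, 2} : Finset (Fin 4)) \ {0} = {1, 2} by decide,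
      show ({0, 1, 2} : Finset (Fin 4)) \ {0, 1} = {2} by decide,
      show ({0, 1, 2} : Finset (Fin 4)) \ {0, 2} = {1} by decide, Finset.sdiff_self,
      ursellOf_singleton, h1, h1, h1, hm0, hodd {0, 1, 2} (by decide)] at h
    linarith
  have hu013 : ursellOf m {0, 1, 3} = 0 := by
    have h := sum_ursellOf_mul_eq m hm0 (show (0 : Fin 4) ∈ ({0, 1, 3} : Finset (Fin 4)) by decide)
    rw [show (({0, 1, 3} : Finset (Fin 4)).powerset.filter fun P => (0 : Fin 4) ∈ P) =
        {{0}, {0, 1}, {0, 3}, {0, 1, 3}} by decide,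
      Finset.sum_insert (by decide), Finset.sum_insert (by decide), Finset.sum_pair (by decide),
      show ({0, 1, 3} : Finset (Fin 4)) \ {0} = {1, 3} by decide,
      show ({0, 1, 3} : Finset (Fin 4)) \ {0, 1} = {3} by decide,
      show ({0, 1, 3} : Finset (Fin 4)) \ {0, 3} = {1} by decide, Finset.sdiff_self,
      ursellOf_singleton, h1, h1, h1, hm0, hodd {0, 1, 3} (by decide)] at h
    linarith
  have hu023 : ursellOf m {0, 2, 3} = 0 := by
    have h := sum_ursellOf_mul_eq m hm0 (show (0 : Fin 4) ∈ ({0, 2, 3} : Finset (Fin 4)) by decide)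
    rw [show (({0, 2, 3} : Finset (Fin 4)).powerset.filter fun P => (0 : Fin 4) ∈ P) =
        {{0}, {0, 2}, {0, 3}, {0, 2, 3}} by decide,
      Finset.sum_insert (by decide), Finset.sum_insert (by decide), Finset.sum_pair (by decide),
      show ({0, 2, 3} : Finset (Fin 4)) \ {0} = {2, 3} by decide,
      show ({0, 2, 3} : Finset (Fin 4)) \ {0, 2} = {3} by decide,
      show ({0, 2, 3} : Finset (Fin 4)) \ {0, 3} = {2} by decide, Finset.sdiff_self,
      ursellOf_singleton, h1, h1, h1, hm0, hodd {0, 2, 3} (by decide)] at h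
    linarith
  -- the block recursion at `0` for the whole index set
  have h := sum_ursellOf_mul_eq m hm0 (Finset.mem_univ (0 : Fin 4))
  rw [show ((univ : Finset (Fin 4)).powerset.filter fun P => (0 : Fin 4) ∈ P) =
      {{0}, {0, 1}, {0, 2}, {0, 3}, {0, 1, 2}, {0, 1, 3}, {0, 2, 3}, univ} by decide,
    Finset.sum_insert (by decide), Finset.sum_insert (by decide), Finset.sum_insert (by decide),
    Finset.sum_insert (by decide), Finset.sum_insert (by decide), Finset.sum_insert (by decide),
    Finset.sum_pair (by decide),
    show (univ : Finset (Fin 4)) \ {0} = {1, 2, 3} by decide,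
    show (univ : Finset (Fin 4)) \ {0, 1} = {2, 3} by decide,
    show (univ : Finset (Fin 4)) \ {0, 2} = {1, 3} by decide,
    show (univ : Finset (Fin 4)) \ {0, 3} = {1, 2} by decide,
    show (univ : Finset (Fin 4)) \ {0, 1, 2} = {3} by decide,
    show (univ : Finset (Fin 4)) \ {0, 1, 3} = {2} by decide,
    show (univ : Finset (Fin 4)) \ {0, 2, 3} = {1} by decide, Finset.sdiff_self,
    ursellOf_singleton, h1, h1, h1, h1, hm0, hu012, hu013, hu023,
    hpair (by decide : (0 : Fin 4) ≠ 1), hpair (by decide : (0 : Fin 4) ≠ 2), hpair (by decide : (0 : Fin 4) ≠ 3)] at h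
  -- moments of pairs and of the four spins
  have hm2 : ∀ {p q : Fin 4}, p ≠ q → m {p, q} = avg c (fun σ => spinAt (j p) σ * spinAt (j q) σ) := by
    intro p q hpq
    simp only [hm, Finset.prod_pair hpq]
  have hm4 : m univ = avg c (fun σ => spinAt (j 0) σ * spinAt (j 1) σ * spinAt (j 2) σ * spinAt (j 3) σ) := by
    simp only [hm, Fin.prod_univ_four]
  rw [hm2 (by decide : (0 : Fin 4) ≠ 1), hm2 (by decide : (0 : Fin 4) ≠ 2), hm2 (by decide : (0 : Fin 4) ≠ 3),
    hm2 (by decide : (2 : Fin 4) ≠ 3), hm2 (by decide : (1 : Fin 4) ≠ 3), hm2 (by decide : (1 : Fin 4) ≠ 2), hm4] at h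
  rw [hU]
  linarith

/-! ### The derivative of `u₄` in one coupling -/

/-- The covariance of an observable with `σ_{u₀}σ_{v₀}`: `⟨f σ_{u₀}σ_{v₀}⟩_c - ⟨f⟩_c⟨σ_{u₀}σ_{v₀}⟩_c`
(`= ∂⟨f⟩/∂J_{u₀v₀}`, `UrsellMonotonicityDeriv.deriv_avg_setCoupling`). [cite: CamiaJiangNewman2023, §2 eq. (20)] -/
def covWith (c : ι → ι → ℝ) (u₀ v₀ : ι) (f : SpinConfig ι → ℝ) : ℝ :=
  avg c (fun ρ => f ρ * (spinAt u₀ ρ * spinAt v₀ ρ)) - avg c f * avg c (fun ρ => spinAt u₀ ρ * spinAt v₀ ρ)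

/-- **CJN eq. (20) for `n = 4`**: with `A_S = ⟨∏_{i∈S} σ_{j i}⟩` and `Cov(S) = ∂A_S/∂J_{u₀v₀}`,
`∂u₄/∂J_{u₀v₀} = Cov(0123) - (Cov(01)A₂₃ + A₀₁Cov(23)) - (Cov(02)A₁₃ + A₀₂Cov(13)) - (Cov(03)A₁₂ + A₀₃Cov(12))`.
[cite: CamiaJiangNewman2023, §2 eq. (20)] -/
theorem deriv_ursell_four (c : ι → ι → ℝ) (u₀ v₀ : ι) (j : Fin 4 → ι) :
    deriv (fun t => ursell (setCoupling c u₀ v₀ t) j) (c u₀ v₀) =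
      covWith c u₀ v₀ (fun σ => spinAt (j 0) σ * spinAt (j 1) σ * spinAt (j 2) σ * spinAt (j 3) σ) -
        (covWith c u₀ v₀ (fun σ => spinAt (j 0) σ * spinAt (j 1) σ) * avg c (fun σ => spinAt (j 2) σ * spinAt (j 3) σ) +
          avg c (fun σ => spinAt (j 0) σ * spinAt (j 1) σ) * covWith c u₀ v₀ (fun σ => spinAt (j 2) σ * spinAt (j 3) σ)) -
        (covWith c u₀ v₀ (fun σ => spinAt (j 0) σ * spinAt (j 2) σ) * avg c (fun σ => spinAt (j 1) σ * spinAt (j 3) σ) +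
          avg c (fun σ => spinAt (j 0) σ * spinAt (j 2) σ) * covWith c u₀ v₀ (fun σ => spinAt (j 1) σ * spinAt (j 3) σ)) -
        (covWith c u₀ v₀ (fun σ => spinAt (j 0) σ * spinAt (j 3) σ) * avg c (fun σ => spinAt (j 1) σ * spinAt (j 2) σ) +
          avg c (fun σ => spinAt (j 0) σ * spinAt (j 3) σ) * covWith c u₀ v₀ (fun σ => spinAt (j 1) σ * spinAt (j 2) σ)) := by
  have hfun : (fun t => ursell (setCoupling c u₀ v₀ t) j) = fun t =>
      avg (setCoupling c u₀ v₀ t) (fun σ => spinAt (j 0) σ * spinAt (j 1) σ * spinAt (j 2) σ * spinAt (j 3) σ) -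
        avg (setCoupling c u₀ v₀ t) (fun σ => spinAt (j 0) σ * spinAt (j 1) σ) *
          avg (setCoupling c u₀ v₀ t) (fun σ => spinAt (j 2) σ * spinAt (j 3) σ) -
        avg (setCoupling c u₀ v₀ t) (fun σ => spinAt (j 0) σ * spinAt (j 2) σ) *
          avg (setCoupling c u₀ v₀ t) (fun σ => spinAt (j 1) σ * spinAt (j 3) σ) -
        avg (setCoupling c u₀ v₀ t) (fun σ => spinAt (j 0) σ * spinAt (j 3) σ) *
          avg (setCoupling c u₀ v₀ t) (fun σ => spinAt (j 1) σ * spinAt (j 2) σ) := by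
    funext t
    exact ursell_four_eq _ j
  rw [hfun]
  have hD := fun f : SpinConfig ι → ℝ => hasDerivAt_avg_setCoupling c u₀ v₀ f (c u₀ v₀)
  simp only [setCoupling_self] at hD
  have h := (((hD (fun σ => spinAt (j 0) σ * spinAt (j 1) σ * spinAt (j 2) σ * spinAt (j 3) σ)).fun_sub
    ((hD (fun σ => spinAt (j 0) σ * spinAt (j 1) σ)).fun_mul (hD (fun σ => spinAt (j 2) σ * spinAt (j 3) σ)))).fun_sub
    ((hD (fun σ => spinAt (j 0) σ * spinAt (j 2) σ)).fun_mul (hD (fun σ => spinAt (j 1) σ * spinAt (j 3) σ)))).fun_sub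
    ((hD (fun σ => spinAt (j 0) σ * spinAt (j 3) σ)).fun_mul (hD (fun σ => spinAt (j 1) σ * spinAt (j 2) σ)))
  simp only [setCoupling_self] at h
  simp only [covWith]
  exact h.deriv

/-! ### Theorem 1 for `k = 2` -/

omit [Fintype ι] in
/-- `{p, q} ∪ {u, v} = {p, q, u, v}`. [folklore] -/
theorem pair_union_pair (p q u v : ι) : ({p, q} : Finset ι) ∪ {u, v} = {p, q, u, v} := by
  ext x; simp only [Finset.mem_union, Finset.mem_insert, Finset.mem_singleton]; tauto

omit [Fintype ι] in
/-- `{x₀, x₁, x₂, x₃} ∪ {u, v} = {x₀, x₁, x₂, x₃, u, v}`. [folklore] -/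
theorem quad_union_pair (x₀ x₁ x₂ x₃ u v : ι) :
    ({x₀, x₁, x₂, x₃} : Finset ι) ∪ {u, v} = {x₀, x₁, x₂, x₃, u, v} := by
  ext x; simp only [Finset.mem_union, Finset.mem_insert, Finset.mem_singleton]; tauto

omit [Fintype ι] in
/-- Pair products are spin products of a pair. [folklore] -/
theorem spinAt_mul_spinAt_eq_spinProduct_pair {p q : ι} (hpq : p ≠ q) :
    (fun σ : SpinConfig ι => spinAt p σ * spinAt q σ) = spinProduct {p, q} := by
  funext σ
  rw [spinProduct, Finset.prod_pair hpq]

/-- Multiplying a spin product by `σ_uσ_v` for `u ≠ v` outside. [folklore] -/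
theorem spinProduct_mul_pair {A : Finset ι} {u v : ι} (hu : u ∉ A) (hv : v ∉ A) (huv : u ≠ v) :
    (fun σ : SpinConfig ι => spinProduct A σ * (spinAt u σ * spinAt v σ)) = spinProduct (A ∪ {u, v}) := by
  funext σ
  rw [show spinAt u σ * spinAt v σ = spinProduct {u, v} σ by rw [spinProduct, Finset.prod_pair huv],
    spinProduct_mul_eq_spinProduct_symmDiff]
  congr 1
  refine Disjoint.symmDiff_eq_sup ?_
  rw [Finset.disjoint_insert_right, Finset.disjoint_singleton_right]
  exact ⟨hu, hv⟩

/-- The covariance of a spin product with `σ_uσ_v` is a switched double-current mass: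
`covWith c u v (σ_A) = D(A ∪ {u,v})/Z[∅]²`. [cite: CamiaJiangNewman2023, §2 eq. (21)–(22)] -/
theorem covWith_spinProduct_eq {c : ι → ι → ℝ} (hc : ∀ a b, 0 ≤ c a b) {A : Finset ι} {u v : ι} (hu : u ∉ A)
    (hv : v ∉ A) (huv : u ≠ v) :
    covWith c u v (spinProduct A) = (Current.dmass (edgeK c) u v (A ∪ {u, v})).toReal / wcurrentSum (edgeK c) ∅ ^ 2 := by
  rw [covWith, spinProduct_mul_pair hu hv huv, spinAt_mul_spinAt_eq_spinProduct_pair huv]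
  exact cov_eq_dmass_div hc hu hv huv

/-- **CJN Theorem 1 for `k = 2`, distinct sites away from `u₀, v₀`**: for `c ≥ 0`, `j : Fin 4 → ι` injective and
`u₀ ≠ v₀ ∉ range j`, `0 ≤ (-1)^{2-1} ∂u₄(c_t; j)/∂t` at `t = c u₀ v₀`.  By `deriv_ursell_four`,
`ursellFour`-type bookkeeping and the dictionary, this is the double-current inequality
`Current.ursellTwo_currentSum_inequality` divided by `Z[∅]³`. [cite: CamiaJiangNewman2023, Thm 1 (case k = 2)] -/
theorem neg_deriv_ursell_four_nonneg {c : ι → ι → ℝ} (hc : ∀ a b, 0 ≤ c a b) (j : Fin 4 → ι) (u₀ v₀ : ι)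
    (hj : Function.Injective j) (hu : u₀ ∉ Set.range j) (hv : v₀ ∉ Set.range j) (huv : u₀ ≠ v₀) :
    0 ≤ (-1 : ℝ) ^ (2 - 1) * deriv (fun t : ℝ => ursell (setCoupling c u₀ v₀ t) j) (c u₀ v₀) := by
  -- the six distinct sites
  have hne : ∀ {p q : Fin 4}, p ≠ q → j p ≠ j q := fun hpq h => hpq (hj h)
  have hxu : ∀ p : Fin 4, u₀ ≠ j p := fun p h => hu ⟨p, h.symm⟩
  have hxv : ∀ p : Fin 4, v₀ ≠ j p := fun p h => hv ⟨p, h.symm⟩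
  have h01 : j 0 ≠ j 1 := hne (by decide)
  have h02 : j 0 ≠ j 2 := hne (by decide)
  have h03 : j 0 ≠ j 3 := hne (by decide)
  have h12 : j 1 ≠ j 2 := hne (by decide)
  have h13 : j 1 ≠ j 3 := hne (by decide)
  have h23 : j 2 ≠ j 3 := hne (by decide)
  have hnd : [j 0, j 1, j 2, j 3, u₀, v₀].Nodup := by
    simp [List.nodup_cons, h01, h02, h03, h12, h13, h23, (hxu _).symm, (hxv _).symm, huv]
  -- notation for the random-current side
  set K := edgeK c with hK
  have hK0 : ∀ e, 0 ≤ K e := edgeK_nonneg hc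
  set Z : Finset ι → ℝ := fun A => wcurrentSum K A with hZ
  set D : Finset ι → ℝ := fun T => (Current.dmass K u₀ v₀ T).toReal with hD
  have hZpos : 0 < Z ∅ := wcurrentSum_edgeK_empty_pos hc
  -- the real form of the double-current inequality
  have hmain : Z ∅ * D {j 0, j 1, j 2, j 3, u₀, v₀} ≤
      Z {j 2, j 3} * D {j 0, j 1, u₀, v₀} + Z {j 1, j 3} * D {j 0, j 2, u₀, v₀} + Z {j 1, j 2} * D {j 0, j 3, u₀, v₀} +
        Z {j 0, j 3} * D {j 1, j 2, u₀, v₀} + Z {j 0, j 2} * D {j 1, j 3, u₀, v₀} + Z {j 0, j 1} * D {j 2, j 3, u₀, v₀} := by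
    have h := Current.ursellTwo_currentSum_inequality hK0 hnd
    have hf : ∀ (A T : Finset ι), ecurrentSum K A * Current.dmass K u₀ v₀ T ≠ ∞ := fun A T =>
      ENNReal.mul_ne_top (ecurrentSum_ne_top hK0 A) (Current.dmass_ne_top hK0 u₀ v₀ T)
    have hf2 := ENNReal.add_ne_top.2 ⟨hf {j 2, j 3} {j 0, j 1, u₀, v₀}, hf {j 1, j 3} {j 0, j 2, u₀, v₀}⟩
    have hf3 := ENNReal.add_ne_top.2 ⟨hf2, hf {j 1, j 2} {j 0, j 3, u₀, v₀}⟩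
    have hf4 := ENNReal.add_ne_top.2 ⟨hf3, hf {j 0, j 3} {j 1, j 2, u₀, v₀}⟩
    have hf5 := ENNReal.add_ne_top.2 ⟨hf4, hf {j 0, j 2} {j 1, j 3, u₀, v₀}⟩
    have hf6 := ENNReal.add_ne_top.2 ⟨hf5, hf {j 0, j 1} {j 2, j 3, u₀, v₀}⟩
    have h' := (ENNReal.toReal_le_toReal (hf _ _) hf6).2 h
    rw [ENNReal.toReal_add hf5 (hf _ _), ENNReal.toReal_add hf4 (hf _ _), ENNReal.toReal_add hf3 (hf _ _),
      ENNReal.toReal_add hf2 (hf _ _), ENNReal.toReal_add (hf _ _) (hf _ _)] at h'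
    simp only [ENNReal.toReal_mul, toReal_ecurrentSum hK0] at h'
    exact h'
  -- the derivative in terms of `Z` and `D`
  have hA : ∀ {p q : Fin 4}, p ≠ q → avg c (fun σ => spinAt (j p) σ * spinAt (j q) σ) = Z {j p, j q} / Z ∅ :=
    fun {p q} hpq => by rw [spinAt_mul_spinAt_eq_spinProduct_pair (hne hpq), avg_spinProduct_eq_div hc]
  have hC2 : ∀ {p q : Fin 4}, p ≠ q →
      covWith c u₀ v₀ (fun σ => spinAt (j p) σ * spinAt (j q) σ) = D {j p, j q, u₀, v₀} / Z ∅ ^ 2 := by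
    intro p q hpq
    have hup : u₀ ∉ ({j p, j q} : Finset ι) := by simp [hxu p, hxu q]
    have hvp : v₀ ∉ ({j p, j q} : Finset ι) := by simp [hxv p, hxv q]
    rw [spinAt_mul_spinAt_eq_spinProduct_pair (hne hpq), covWith_spinProduct_eq hc hup hvp huv, pair_union_pair]
  have hC4 : covWith c u₀ v₀ (fun σ => spinAt (j 0) σ * spinAt (j 1) σ * spinAt (j 2) σ * spinAt (j 3) σ) =
      D {j 0, j 1, j 2, j 3, u₀, v₀} / Z ∅ ^ 2 := by
    have hf : (fun σ : SpinConfig ι => spinAt (j 0) σ * spinAt (j 1) σ * spinAt (j 2) σ * spinAt (j 3) σ) =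
        spinProduct {j 0, j 1, j 2, j 3} := by
      funext σ
      rw [spinProduct, Finset.prod_insert (by simp [h01, h02, h03]), Finset.prod_insert (by simp [h12, h13]),
        Finset.prod_pair h23]
      ring
    have hu4 : u₀ ∉ ({j 0, j 1, j 2, j 3} : Finset ι) := by simp [hxu]
    have hv4 : v₀ ∉ ({j 0, j 1, j 2, j 3} : Finset ι) := by simp [hxv]
    rw [hf, covWith_spinProduct_eq hc hu4 hv4 huv, quad_union_pair]
  rw [deriv_ursell_four, hC4, hC2 (by decide : (0 : Fin 4) ≠ 1), hC2 (by decide : (2 : Fin 4) ≠ 3),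
    hC2 (by decide : (0 : Fin 4) ≠ 2), hC2 (by decide : (1 : Fin 4) ≠ 3), hC2 (by decide : (0 : Fin 4) ≠ 3),
    hC2 (by decide : (1 : Fin 4) ≠ 2), hA (by decide : (0 : Fin 4) ≠ 1), hA (by decide : (2 : Fin 4) ≠ 3),
    hA (by decide : (0 : Fin 4) ≠ 2), hA (by decide : (1 : Fin 4) ≠ 3), hA (by decide : (0 : Fin 4) ≠ 3),
    hA (by decide : (1 : Fin 4) ≠ 2)]
  -- clear denominators
  have hZ0 : Z ∅ ≠ 0 := hZpos.ne'
  rw [show (2 : ℕ) - 1 = 1 from rfl, pow_one]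
  have key : (-1 : ℝ) * (D {j 0, j 1, j 2, j 3, u₀, v₀} / Z ∅ ^ 2 -
      (D {j 0, j 1, u₀, v₀} / Z ∅ ^ 2 * (Z {j 2, j 3} / Z ∅) + Z {j 0, j 1} / Z ∅ * (D {j 2, j 3, u₀, v₀} / Z ∅ ^ 2)) -
      (D {j 0, j 2, u₀, v₀} / Z ∅ ^ 2 * (Z {j 1, j 3} / Z ∅) + Z {j 0, j 2} / Z ∅ * (D {j 1, j 3, u₀, v₀} / Z ∅ ^ 2)) -
      (D {j 0, j 3, u₀, v₀} / Z ∅ ^ 2 * (Z {j 1, j 2} / Z ∅) + Z {j 0, j 3} / Z ∅ * (D {j 1, j 2, u₀, v₀} / Z ∅ ^ 2))) =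
      (Z {j 2, j 3} * D {j 0, j 1, u₀, v₀} + Z {j 1, j 3} * D {j 0, j 2, u₀, v₀} + Z {j 1, j 2} * D {j 0, j 3, u₀, v₀} +
        Z {j 0, j 3} * D {j 1, j 2, u₀, v₀} + Z {j 0, j 2} * D {j 1, j 3, u₀, v₀} + Z {j 0, j 1} * D {j 2, j 3, u₀, v₀} -
        Z ∅ * D {j 0, j 1, j 2, j 3, u₀, v₀}) / Z ∅ ^ 3 := by
    field_simp
    ring
  rw [key]
  exact div_nonneg (by linarith) (by positivity)

end PairIsing

/-- **Camia–Jiang–Newman 2023, Theorem 1 in the case `k = 2` (PROVED)**: for ferromagnetic pair interactions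
`c ≥ 0` on a finite set, any sites `j : Fin 4 → ι` (not necessarily distinct) and any ordered pair `u₀ ≠ v₀`,
`0 ≤ (-1)^{2-1} · d/dt|_{t = c_{u₀v₀}} u₄(setCoupling c u₀ v₀ t; j)`, i.e. `|u₄| = -u₄` is nondecreasing in every
coupling — the `k = 2` instance of the body of the named fact `CamiaJiangNewman2023_thm1`.  Distinct sites away from
`u₀, v₀`: `PairIsing.neg_deriv_ursell_four_nonneg` (double currents); general case: the clone trick of
`UrsellMonotonicityClones.lean` (`u₄` of the clones is `(tanh 1)^4 u₄`). The general `k` is NOT proved in the tree.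
[cite: CamiaJiangNewman2023, Thm 1 (case k = 2)] -/
theorem CamiaJiangNewman2023_thm1_two (ι : Type) [Fintype ι] [DecidableEq ι] (c : ι → ι → ℝ)
    (hc : ∀ a b, 0 ≤ c a b) (j : Fin (2 * 2) → ι) (u₀ v₀ : ι) (huv : u₀ ≠ v₀) :
    0 ≤ (-1 : ℝ) ^ (2 - 1) *
      deriv (fun t : ℝ => PairIsing.ursell (PairIsing.setCoupling c u₀ v₀ t) j) (c u₀ v₀) := by
  have key := PairIsing.neg_deriv_ursell_four_nonneg (ι := ι ⊕ Fin (2 * 2))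
    (PairIsing.cloneCoupling_nonneg hc j zero_le_one) Sum.inr (Sum.inl u₀) (Sum.inl v₀)
    Sum.inr_injective (by simp) (by simp) (by simpa using huv)
  have hfun : (fun t : ℝ => PairIsing.ursell
      (PairIsing.setCoupling (PairIsing.cloneCoupling c j 1) (Sum.inl u₀) (Sum.inl v₀) t) Sum.inr) =
      fun t => Real.tanh 1 ^ (2 * 2) * PairIsing.ursell (PairIsing.setCoupling c u₀ v₀ t) j := by
    funext t
    rw [← PairIsing.cloneCoupling_setCoupling, PairIsing.ursell_cloneCoupling]
  rw [hfun, PairIsing.cloneCoupling_inl_inl,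
    deriv_const_mul _ ((PairIsing.differentiable_ursell_setCoupling c u₀ v₀ j) _)] at key
  have hpos : 0 < Real.tanh 1 ^ (2 * 2) := by
    refine pow_pos ?_ _
    rw [Real.tanh_eq_sinh_div_cosh]
    exact div_pos (Real.sinh_pos_iff.2 one_pos) (Real.cosh_pos 1)
  rw [mul_left_comm] at key
  exact nonneg_of_mul_nonneg_right (by simpa [mul_comm] using key) hpos

/-- Consistency check: the named fact `CamiaJiangNewman2023_thm1` specialised to `k = 2` is literally the
statement of `CamiaJiangNewman2023_thm1_two`. [cite: CamiaJiangNewman2023, Thm 1 (case k = 2)] -/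
example (h : CamiaJiangNewman2023_thm1) (ι : Type) [Fintype ι] [DecidableEq ι] (c : ι → ι → ℝ)
    (hc : ∀ a b, 0 ≤ c a b) (j : Fin (2 * 2) → ι) (u₀ v₀ : ι) (huv : u₀ ≠ v₀) :
    0 ≤ (-1 : ℝ) ^ (2 - 1) *
      deriv (fun t : ℝ => PairIsing.ursell (PairIsing.setCoupling c u₀ v₀ t) j) (c u₀ v₀) :=
  h ι c hc 2 (by norm_num) j u₀ v₀ huv

end Literature.Probability.LatticeModels
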